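/-
Copyright: public-domain mathematics; formalisation produced inside the b2b autopsy cell `lwe-quantum-autopsy`
(Part 1, generation 14).  Source analysed: Yilei Chen, "Quantum Algorithms for Lattice Problems",
IACR ePrint 2024/555, version of 2024-04-18 (WITHDRAWN by the author: "Step 9 of the algorithm contains a
bug, which I don't know how to fix").  Bib key `ChenQuantumLattice2024`.
-/
import Literature.Computability.Cryptography.ChenQuantumLWEThresholdOrder

/-!
# Chen (2024), Step 8: the tolerance threshold of the measurement ceiling is `Θ(1/𝔭(Q)²)` for EVERY admissible `Q`

HONEST FRAMING.  The value of this file is a kernel-checked THEOREM about one step of a WITHDRAWN quantum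
algorithm (Chen, ePrint 2024/555 v. 2024-04-18, §3.5.8 Step 8).  It is NOT progress on any summit problem,
breaks nothing, repairs nothing, and makes no cryptanalytic claim: it quantifies how INSENSITIVE the failure of
Step 8 (to distinguish instances with different Step-9 requirements) is to approximate measurement.

## What was open

(Q) `ChenQuantumLWEMeasurementThreshold` and (Y) `ChenQuantumLWEThresholdOrder` determined the order of the
tolerance `ε` below which every `ε`-almost-sure general measurement (POVM) of the Step-8 register is constant on
Chen's orbit pair `(b, v′)`, `(b, v′ + 2D²p₁b)`: sufficient `4ε·q² < 1` for every factor of a pairwise-coprime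
factorisation `Q = ∏ qᵢ` ((Q), union bound over one cyclic move per factor), failure at `ε = 1/p²` for every
prime `p ∣ Q` ((Y), the divisor-orbit witness).  For SQUAREFREE `Q` — Chen's own `Q = p₂⋯p_κ` with distinct
planted primes — this is the exact order `1/𝔭(Q)²`, `𝔭(Q)` the largest prime factor
(`Shape.step8_povm_ceiling_order_squarefree`, constants `[1/4, 1]`).  The formal admissibility predicate
`Shape.Admissible` (odd `Q ≥ 3` coprime to `D·p₁`, `Q ≡ −1 (mod p₁)`) does not force `Q` squarefree, and for
`Q = ∏ pᵢ^{aᵢ}` the docstring of (Y) records the window `[1/(4·max pᵢ^{2aᵢ}), 1/𝔭(Q)²]`: the union bound of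
(Q)/(W) over the `p^{2a}`-element orbit inside a prime-power factor loses `p^{2a}` where the witness loses `p²`.

## What is proved here

* `Shape.step8_povm_ceiling_largestPrime` — **for EVERY admissible shape, `32·ε·p² ≤ 1` for every prime
  `p ∣ Q` (i.e. `32·ε·𝔭(Q)² ≤ 1`) suffices:** an `ε`-almost-sure POVM on the class `InClass U` (one unknown
  tail coordinate, `t₁+1 ∈ U`) gives `|φ7.d⟩` of `S` and of the shifted instance the same almost-certain
  outcome.
* `Shape.step8_povm_ceiling_order` — with (Y)'s `Shape.step8_povm_ceiling_fails_at_inv_prime_sq`: **the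
  threshold is `Θ(1/𝔭(Q)²)` for ALL admissible `Q`, constants in `[1/32, 1]`** — prime powers included; for
  squarefree `Q` a second proof of (Y)'s order theorem with NO union bound (constant `32` instead of `4`).
* `Shape.step8_povm_ceiling_largestPrime_offsets` (v2) — the same conclusion for EVERY same-slope pair
  `(b₂, v₂) ∈ InClass U`, `(b₂, v₃)` with `v₃ ≡ v₂ + 2D²p₁·(a·b₂ + m) (mod M)` (`a ∈ ℤ`, `m` supported on the
  unknown coordinates, `m₀ = 0`): (W)'s `Shape.step8_povm_ceiling_dvd` for all divisor levels at once under
  `32·ε·𝔭(Q)² ≤ 1`; pairs with DIFFERENT slopes on `U` are Part XII (v3).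
* `Shape.step8_cannot_supply_step9Needs_povm_largestPrime(')`, `Shape.step9Needs_not_almostSurely_measurable_largestPrime`
  (v2) — the packaged corollaries of (P)/(W) ("same `b`, same `step8Output`, different `step9Needs`, same
  almost-certain outcome"; "`step9Needs` is not `ε`-almost certainly measurable on the class") at tolerance
  `32·ε·𝔭(Q)² ≤ 1` in place of `4·ε·P² < 1` / `4·ε·Q² < 1`.
* `POVM.frame_link` (v3, Part IX) — abstract: an orthogonal frame all of whose members are almost certainly
  `k₀`, lying in the span of an orthogonal test family with the same Gram constant, and a test box at least as
  large as the frame each of whose members has FULL mass on the frame and is almost certainly `k₁`, force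
  `k₀ = k₁` as soon as `ε < 1/2` (the defect trace computed two ways).
* `Shape.reslope`, `Shape.uKet_reslope` (v3, Part X) — the re-sloping dictionary: the dummy-slope-`γ` family of
  `S` IS the straightened family of the admissible shape `S.reslope γ` (slopes `b + 2p₁·γ`), so Part V applies
  to every slope family of the class.
* `Shape.sameOut_uKet` (v3, Part XI) — **slope invariance:** under `32·ε·p² ≤ 1` (`p ∣ Q` prime) every member
  `(β; x, ȳ)` of the class (`β` on the unknown coordinates) has the almost-certain outcome of the straightened
  member with the same known coordinates (`Shape.link_step` = `frame_link` between the `Q^{1+#T}`-box of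
  straightened members and the box of slope-`e_τ` test vectors; bumps `γ ↦ γ + e_τ`; induction).
* `Shape.step8_povm_ceiling_largestPrime_pairs` (v3, Part XII) — **(W)'s `Shape.step8_povm_ceiling_sharp` for
  ALL pairs `(b₂, v₂), (b₃, v₃) ∈ InClass U` (any admissible unknown slopes) with
  `v₃ ≡ v₂ + 2D²p₁·(a·b₂ + m) (mod M)`, at tolerance `32·ε·𝔭(Q)² ≤ 1` instead of `4·ε·Q² < 1`:** the robust
  Step-8 ceiling in its full two-instance form holds at the sharp order `Θ(1/𝔭(Q)²)` for every admissible `Q`.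

## Method: exact outcome invariance by induction over the divisor lattice (frames, not union bounds)

Work in the base class of `S` ((V) `ChenQuantumLWEReadoutClass`: shape `S.cshape (S.cosetOf v′)`, members
`|u_{β;x,ȳ}⟩`, (Y) `Shape.uKet`) and STRAIGHTEN the coordinates: `Z_{x,w} := |u_{0; x, w − x·b̄}⟩`
(`Shape.zKet`, `b̄ = b mod Q` on the tail), so that Chen's shift is `(x, w) ↦ (x − 1, w)` and `S`, shifted `S`
are `Z_{x₀,w₀}`, `Z_{x₀−1,w₀}` (`phi7d_eq_uKet`, `phi7d_shift_eq_uKet`).  OUTCOME INVARIANCE AT MODULUS `H ∣ Q`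
(`Shape.OutInv`): members whose `x` and unknown coordinates `w_t (t+1 ∈ U)` differ by `H`-torsion elements
(`H·Δ = 0` in `ℤ_Q`) have equal almost-certain outcomes.  `H = 1` is outcome uniqueness (`ε < 1/2`); `H = Q` is
the theorem; and `OutInv H₀ ⇒ OutInv (p·H₀)` at cost `32εp² ≤ 1` (`Shape.outInv_step`), whence strong induction
over the divisors of `Q` (`Shape.outInv_of_dvd`).  The step is a chain (move `x`, then one unknown coordinate
at a time) of ELEMENTARY STEPS `Shape.outInv_elem_step`, each an instance of the abstract
`POVM.frame_endgame`: two orthogonal frames `O⁰, O¹` (the `H₀`-orbit boxes of the two members — constant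
outcomes `k₀, k₁` by the induction hypothesis) inside the span of an orthogonal TEST FAMILY `u_v` of class
members (dummy slope `G′·e_τ`, `Q = G′H′`, on the moving coordinate `τ`: `Shape.tKet`), a test set `F` with
`#F = p²·#O` on which every `u_v` has mass exactly `ρ = 1/p²` on either frame (the exact overlap formula
`Shape.normSq_zKet_tKet`: `‖⟨Z_{x,w}|u^τ_{x′,w′}⟩‖² = (ν/Qⁿ/H′)²·[H′(x−x′) = 0 ∧ H′(w_τ−w′_τ) = 0 ∧ w = w′ off τ]`,
a coset character sum `norm_sum_spike_stdAddChar`).  If `k₀ ≠ k₁`, each `u_v (v ∈ F)` misses one of them, its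
component `P⁰u_v` (or `P¹u_v`) of norm² `ρa` then has defect `⟨P u|(1 − E_{k})|P u⟩ > aρ²/16`
(`POVM.defect_lower_bound`, a two-piece triangle inequality), so one frame collects total defect
`> #F·aρ²/32`; but Bessel's EQUALITY `Z ∈ span{u_v}` (`Shape.sum_normSq_tKet_zKet`, `eq_frameProj_of_bessel`)
turns `Σ_v ⟨P u_v|X|P u_v⟩` into the frame trace `Σ_j ⟨O_j|X|O_j⟩ ≤ ε·a·#O` (`sum_star_frameProj_mulVec`,
`POVM.total_defect_le`) — contradiction exactly when `32ε·#O ≤ ρ²·#F`, i.e. `32εp² ≤ 1`.  No phase of any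
overlap is ever used (only squared moduli), and no union bound over orbit members is taken.

SLOPES (v3).  The straightened family (slope `0`) and the slope-`e_τ` test family over one `ℤ_Q^{1+#T}`-box
(all of `x` and the unknown coordinates free) are two orthogonal bases of ONE space (`sum_orbit_normSq` at
`H₀ = H′ = Q`, `sum_normSq_tKet_zKet`), each outcome-constant once Part V is known for `S` and for the
re-sloped shape `S.reslope e_τ` — whose straightened family is exactly the test family (`Shape.reslope`,
`tKet_one_eq_reslope_zKet`); `POVM.frame_link` then identifies the two constants at cost `ε < 1/2`
(`Shape.link_step`), the bump `γ ↦ γ + e_τ` is the same statement for `S.reslope γ` (`sameOut_bump`), and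
induction over the dummy values and the unknown coordinates gives `Shape.sameOut_uKet`.  An arbitrary second
class instance `(b₃, v₃)` has slopes `b₃ ≡ famBT univ β (mod P)` relative to `(b₂, v₂)` with `β` on the
unknown coordinates (`2p₁ ∣ b_i`, `P = p₁Q`), so it is a member `(β; x₀ − a, ȳ₀ + a·b̄ + m̄)` of the base
class (`phi7d_inst_famBT_shift_eq_uKet`) — Part XII.

References: [ChenQuantumLattice2024] Y. Chen, Quantum Algorithms for Lattice Problems, IACR ePrint 2024/555,
version 2024-04-18: Cond. C.3 p. 18, §3.1 p. 22, eq. (35) p. 31, Lemma 3.13 pp. 32–34, §3.5.8 pp. 33–34, p. 37;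
[NielsenChuang2010] M. Nielsen, I. Chuang, Quantum Computation and Quantum Information, CUP 2010, §2.2.6 p. 90
(POVM formalism), Box 2.3 p. 87 (completeness relation / Bessel).
-/

open scoped BigOperators ComplexOrder MatrixOrder
open Matrix Finset

namespace Literature.Computability.Cryptography.Chen2024

/-! ## Part I.  Frames: the projector onto the span of an orthogonal family, Bessel ⇒ expansion, trace identity -/

section Frame

variable {X : Type*} [Fintype X]

/-- `conj ⟨u|w⟩ = ⟨w|u⟩`. [folklore] -/
theorem conj_star_dotProduct (u w : X → ℂ) : (starRingEnd ℂ) (star u ⬝ᵥ w) = star w ⬝ᵥ u := by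
  simp only [dotProduct, map_sum, Pi.star_apply, map_mul, Complex.star_def, Complex.conj_conj]
  exact Finset.sum_congr rfl fun i _ => mul_comm _ _

/-- `‖⟨u|w⟩‖ = ‖⟨w|u⟩‖`. [folklore] -/
theorem norm_star_dotProduct_comm (u w : X → ℂ) : ‖star u ⬝ᵥ w‖ = ‖star w ⬝ᵥ u‖ := by
  rw [← conj_star_dotProduct u w, Complex.norm_conj]

/-- `conj z · z = ‖z‖²` as a complex number. [folklore] -/
theorem conj_mul_self_eq_norm_sq (z : ℂ) : (starRingEnd ℂ) z * z = ((‖z‖ ^ 2 : ℝ) : ℂ) := by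
  rw [Complex.conj_mul']
  push_cast
  rfl

/-- A matrix acts term by term on a finite sum of vectors. [folklore] -/
theorem mulVec_fintype_sum {J : Type*} [Fintype J] (A : Matrix X X ℂ) (f : J → X → ℂ) :
    A *ᵥ (∑ j, f j) = ∑ j, A *ᵥ f j := by
  funext i
  simp only [Matrix.mulVec, dotProduct, Finset.sum_apply, Finset.mul_sum]
  rw [Finset.sum_comm]

variable {J : Type*} [Fintype J] [DecidableEq J]

omit [DecidableEq J] in
/-- The orthogonal projection onto the span of an orthogonal family `(O_j)` of vectors of common norm²
`a`: `P u := a⁻¹·Σ_j ⟨O_j|u⟩·O_j`. [folklore] -/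
noncomputable def frameProj (O : J → X → ℂ) (a : ℝ) (u : X → ℂ) : X → ℂ :=
  ∑ j, (((a : ℂ))⁻¹ * (star (O j) ⬝ᵥ u)) • O j

omit [DecidableEq J] in
/-- `⟨w|P u⟩ = Σ_j a⁻¹⟨O_j|u⟩⟨w|O_j⟩`. [folklore] -/
theorem star_dotProduct_frameProj (O : J → X → ℂ) (a : ℝ) (u w : X → ℂ) :
    star w ⬝ᵥ frameProj O a u = ∑ j, ((a : ℂ))⁻¹ * (star (O j) ⬝ᵥ u) * (star w ⬝ᵥ O j) := by
  unfold frameProj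
  rw [dotProduct_sum]
  exact Finset.sum_congr rfl fun j _ => by rw [dotProduct_smul, smul_eq_mul]

omit [DecidableEq J] in
/-- `⟨P u|w⟩ = Σ_j a⁻¹·conj⟨O_j|u⟩·⟨O_j|w⟩`. [folklore] -/
theorem star_frameProj_dotProduct (O : J → X → ℂ) (a : ℝ) (u w : X → ℂ) :
    star (frameProj O a u) ⬝ᵥ w
      = ∑ j, ((a : ℂ))⁻¹ * (starRingEnd ℂ) (star (O j) ⬝ᵥ u) * (star (O j) ⬝ᵥ w) := by
  unfold frameProj
  rw [star_sum, sum_dotProduct]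
  refine Finset.sum_congr rfl fun j _ => ?_
  rw [star_smul, smul_dotProduct, smul_eq_mul, Complex.star_def, map_mul, map_inv₀, Complex.conj_ofReal]

/-- `⟨O_i|P u⟩ = ⟨O_i|u⟩` for an orthogonal family. [folklore] -/
theorem frame_dotProduct_frameProj (O : J → X → ℂ) {a : ℝ} (ha : 0 < a)
    (hO : ∀ j j', star (O j) ⬝ᵥ O j' = if j = j' then ((a : ℂ)) else 0) (u : X → ℂ) (i : J) :
    star (O i) ⬝ᵥ frameProj O a u = star (O i) ⬝ᵥ u := by
  rw [star_dotProduct_frameProj]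
  have ha0 : ((a : ℂ)) ≠ 0 := by exact_mod_cast ha.ne'
  rw [Finset.sum_eq_single i (fun j _ hj => by rw [hO i j, if_neg (Ne.symm hj), mul_zero])
    (fun hi => absurd (Finset.mem_univ i) hi), hO i i, if_pos rfl]
  field_simp

/-- `⟨P u|P u⟩ = a⁻¹·Σ_j ‖⟨O_j|u⟩‖²`. [folklore] -/
theorem star_frameProj_self (O : J → X → ℂ) {a : ℝ} (ha : 0 < a)
    (hO : ∀ j j', star (O j) ⬝ᵥ O j' = if j = j' then ((a : ℂ)) else 0) (u : X → ℂ) :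
    star (frameProj O a u) ⬝ᵥ frameProj O a u = ((a⁻¹ * ∑ j, ‖star (O j) ⬝ᵥ u‖ ^ 2 : ℝ) : ℂ) := by
  rw [star_frameProj_dotProduct]
  push_cast
  rw [Finset.mul_sum]
  refine Finset.sum_congr rfl fun j _ => ?_
  rw [frame_dotProduct_frameProj O ha hO u j, mul_assoc, conj_mul_self_eq_norm_sq]
  push_cast
  ring

/-- `⟨P u|u⟩ = ⟨P u|P u⟩`, i.e. `P u ⊥ u − P u`. [folklore] -/
theorem star_frameProj_dotProduct_sub (O : J → X → ℂ) {a : ℝ} (ha : 0 < a)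
    (hO : ∀ j j', star (O j) ⬝ᵥ O j' = if j = j' then ((a : ℂ)) else 0) (u : X → ℂ) :
    star (frameProj O a u) ⬝ᵥ (u - frameProj O a u) = 0 := by
  rw [dotProduct_sub, star_frameProj_self O ha hO u, star_frameProj_dotProduct, sub_eq_zero]
  push_cast
  rw [Finset.mul_sum]
  refine Finset.sum_congr rfl fun j _ => ?_
  rw [mul_assoc, conj_mul_self_eq_norm_sq]
  push_cast
  ring

omit [DecidableEq J] in
/-- The quadratic form of a matrix on `P u`: `⟨P u|A|P u⟩ = Σ_{j,j′} a⁻²·conj⟨O_j|u⟩·⟨O_{j′}|u⟩·⟨O_j|A|O_{j′}⟩`.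
[folklore] -/
theorem star_frameProj_mulVec_frameProj (O : J → X → ℂ) (a : ℝ) (A : Matrix X X ℂ) (u : X → ℂ) :
    star (frameProj O a u) ⬝ᵥ (A *ᵥ frameProj O a u)
      = ∑ j, ∑ j', ((a : ℂ))⁻¹ * (starRingEnd ℂ) (star (O j) ⬝ᵥ u)
          * (((a : ℂ))⁻¹ * (star (O j') ⬝ᵥ u)) * (star (O j) ⬝ᵥ (A *ᵥ O j')) := by
  rw [star_frameProj_dotProduct]
  refine Finset.sum_congr rfl fun j _ => ?_
  unfold frameProj
  rw [mulVec_fintype_sum, dotProduct_sum, Finset.mul_sum]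
  refine Finset.sum_congr rfl fun j' _ => ?_
  rw [Matrix.mulVec_smul, dotProduct_smul, smul_eq_mul]
  ring

/-- **Bessel's equality forces the expansion:** if `(u_v)` is an orthogonal family of common norm² `a > 0`
and `Σ_v ‖⟨u_v|w⟩‖² = a·⟨w|w⟩`, then `w = a⁻¹Σ_v ⟨u_v|w⟩ u_v` (the residual has norm `0`). [folklore] -/
theorem eq_frameProj_of_bessel {V : Type*} [Fintype V] [DecidableEq V] (uf : V → X → ℂ) {a : ℝ}
    (ha : 0 < a) (huf : ∀ v v', star (uf v) ⬝ᵥ uf v' = if v = v' then ((a : ℂ)) else 0)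
    (w : X → ℂ) (hB : ∑ v, ‖star (uf v) ⬝ᵥ w‖ ^ 2 = a * (star w ⬝ᵥ w).re) :
    w = frameProj uf a w := by
  set w' := frameProj uf a w with hw'
  have h1 : star w' ⬝ᵥ w' = ((a⁻¹ * ∑ v, ‖star (uf v) ⬝ᵥ w‖ ^ 2 : ℝ) : ℂ) :=
    star_frameProj_self uf ha huf w
  have h2 : star w' ⬝ᵥ w = ((a⁻¹ * ∑ v, ‖star (uf v) ⬝ᵥ w‖ ^ 2 : ℝ) : ℂ) := by
    have h := star_frameProj_dotProduct_sub uf ha huf w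
    rw [dotProduct_sub, sub_eq_zero] at h
    rw [← hw'] at h
    rw [h, h1]
  have h3 : star w ⬝ᵥ w' = ((a⁻¹ * ∑ v, ‖star (uf v) ⬝ᵥ w‖ ^ 2 : ℝ) : ℂ) := by
    rw [← conj_star_dotProduct w' w, h2, Complex.conj_ofReal]
  have hww : star w ⬝ᵥ w = (((star w ⬝ᵥ w).re : ℝ) : ℂ) :=
    Complex.ext rfl (star_dotProduct_self_im w)
  have hsum : (a⁻¹ * ∑ v, ‖star (uf v) ⬝ᵥ w‖ ^ 2 : ℝ) = (star w ⬝ᵥ w).re := by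
    rw [hB, ← mul_assoc, inv_mul_cancel₀ ha.ne', one_mul]
  rw [hsum] at h1 h2 h3
  have hres : star (w - w') ⬝ᵥ (w - w') = 0 := by
    rw [star_sub, sub_dotProduct, dotProduct_sub, dotProduct_sub, h1, h2, h3, sub_self, sub_zero, sub_eq_zero]
    exact hww
  have h0 : w - w' = 0 := (dotProduct_star_self_eq_zero).1 (by simpa using hres)
  exact (sub_eq_zero.1 h0)

/-- **Trace identity.**  If the orthogonal family `(O_j)` (norm² `a`) lies in the span of the orthogonal family
`(u_v)` (norm² `a`), then for every matrix `A`: `Σ_v ⟨P u_v|A|P u_v⟩ = Σ_j ⟨O_j|A|O_j⟩`, `P` the projection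
onto the span of the `O_j`. [folklore] -/
theorem sum_star_frameProj_mulVec {V : Type*} [Fintype V] [DecidableEq V] (O : J → X → ℂ)
    (uf : V → X → ℂ) {a : ℝ} (ha : 0 < a)
    (hO : ∀ j j', star (O j) ⬝ᵥ O j' = if j = j' then ((a : ℂ)) else 0)
    (hexp : ∀ j, O j = frameProj uf a (O j)) (A : Matrix X X ℂ) :
    ∑ v, star (frameProj O a (uf v)) ⬝ᵥ (A *ᵥ frameProj O a (uf v)) = ∑ j, star (O j) ⬝ᵥ (A *ᵥ O j) := by
  have ha0 : ((a : ℂ)) ≠ 0 := by exact_mod_cast ha.ne'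
  -- the key sum `Σ_v conj⟨O_j|u_v⟩⟨O_{j′}|u_v⟩ = a·⟨O_{j′}|O_j⟩`
  have key : ∀ j j', ∑ v, (starRingEnd ℂ) (star (O j) ⬝ᵥ uf v) * (star (O j') ⬝ᵥ uf v)
      = ((a : ℂ)) * (star (O j') ⬝ᵥ O j) := by
    intro j j'
    have h := star_dotProduct_frameProj uf a (O j) (O j')
    rw [← hexp j] at h
    rw [h, Finset.mul_sum]
    refine Finset.sum_congr rfl fun v _ => ?_
    rw [conj_star_dotProduct]
    field_simp
  calc ∑ v, star (frameProj O a (uf v)) ⬝ᵥ (A *ᵥ frameProj O a (uf v))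
      = ∑ v, ∑ j, ∑ j', ((a : ℂ))⁻¹ * (starRingEnd ℂ) (star (O j) ⬝ᵥ uf v)
          * (((a : ℂ))⁻¹ * (star (O j') ⬝ᵥ uf v)) * (star (O j) ⬝ᵥ (A *ᵥ O j')) :=
        Finset.sum_congr rfl fun v _ => star_frameProj_mulVec_frameProj O a A (uf v)
    _ = ∑ j, ∑ j', ((a : ℂ))⁻¹ * ((a : ℂ))⁻¹ * (star (O j) ⬝ᵥ (A *ᵥ O j'))
          * ∑ v, (starRingEnd ℂ) (star (O j) ⬝ᵥ uf v) * (star (O j') ⬝ᵥ uf v) := by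
        rw [Finset.sum_comm]
        refine Finset.sum_congr rfl fun j _ => ?_
        rw [Finset.sum_comm]
        refine Finset.sum_congr rfl fun j' _ => ?_
        rw [Finset.mul_sum]
        exact Finset.sum_congr rfl fun v _ => by ring
    _ = ∑ j, star (O j) ⬝ᵥ (A *ᵥ O j) := by
        refine Finset.sum_congr rfl fun j _ => ?_
        rw [Finset.sum_eq_single j (fun j' _ hj => by
          rw [key, hO j' j, if_neg hj, mul_zero, mul_zero]) (fun hj => absurd (Finset.mem_univ j) hj),
          key, hO j j, if_pos rfl]
        field_simp

end Frame

/-! ## Part II.  The defect of a straddling vector and the frame endgame -/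

namespace POVM

variable {X κ : Type*} [Fintype X] [DecidableEq X] [Fintype κ] [DecidableEq κ] (E : POVM X κ)

/-- **The defect lower bound (Cauchy–Schwarz twice).**  Let `E_k` be an effect, `u` a vector of norm² `a`
whose weight on `k` is at most `εa`, and `v ⊥ u − v` a component of `u` of norm² `ρa` (`0 < ρ ≤ 1`).
If `32ε ≤ ρ` then `⟨v|(1 − E_k)|v⟩ > aρ²/16`: a vector that does NOT have outcome `k` cannot have a
`ρ`-heavy component on which `k` is nearly certain. [cite: NielsenChuang2010, Box 2.3 p. 87, §2.2.6 p. 90] -/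
theorem defect_lower_bound (k : κ) {ε ρ a : ℝ} (ha : 0 < a) (hρ : 0 < ρ) (hρ1 : ρ ≤ 1)
    (hε : 32 * ε ≤ ρ) {u v : X → ℂ} (hu : star u ⬝ᵥ u = ((a : ℂ)))
    (hv : star v ⬝ᵥ v = (((ρ * a : ℝ)) : ℂ)) (horth : star v ⬝ᵥ (u - v) = 0)
    (hw : (E.weight u k).re ≤ ε * a) :
    a * ρ ^ 2 / 16 < (star v ⬝ᵥ ((1 - E.effect k) *ᵥ v)).re := by
  by_contra hcon
  push Not at hcon
  set T := E.effect k with hT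
  set z₁ := star v ⬝ᵥ (T *ᵥ u) with hz₁
  set z₂ := star v ⬝ᵥ ((1 - T) *ᵥ (u - v)) with hz₂
  set m := (star v ⬝ᵥ (T *ᵥ v)).re with hm
  set δ := (star v ⬝ᵥ ((1 - T) *ᵥ v)).re with hδ
  -- real bookkeeping
  have hvu : star v ⬝ᵥ u = (((ρ * a : ℝ)) : ℂ) := by
    have h := horth
    rw [dotProduct_sub, sub_eq_zero] at h
    rw [h, hv]
  -- the split `⟨v|T|v⟩ = z₁ + z₂`
  have hsplit : star v ⬝ᵥ (T *ᵥ v) = z₁ + z₂ := by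
    rw [hz₂, hz₁, Matrix.sub_mulVec, Matrix.one_mulVec, Matrix.mulVec_sub, dotProduct_sub, dotProduct_sub,
      dotProduct_sub, hvu, hv]
    ring
  have huv : star u ⬝ᵥ v = (((ρ * a : ℝ)) : ℂ) := by
    rw [← conj_star_dotProduct v u, hvu, Complex.conj_ofReal]
  have hmδ : m + δ = ρ * a := by
    have h := E.dotProduct_one_sub_mulVec v v k
    rw [← hT, hv] at h
    have h' := congrArg Complex.re h
    rw [Complex.sub_re, Complex.ofReal_re] at h'
    rw [hδ, hm]
    linarith
  have hm0 : 0 ≤ m := E.weight_re_nonneg v k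
  have hδ0 : 0 ≤ δ := (Complex.nonneg_iff.1 ((E.posSemidef_one_sub k).dotProduct_mulVec_nonneg v)).1
  have hwu0 : 0 ≤ (E.weight u k).re := E.weight_re_nonneg u k
  have hε0 : 0 ≤ ε := by nlinarith
  -- Cauchy–Schwarz for `T`: `‖z₁‖² ≤ m·⟨u|T|u⟩ ≤ m·εa`
  have cs1 : ‖z₁‖ ^ 2 ≤ m * (ε * a) := by
    have h := norm_sq_dotProduct_mulVec_le (E.posSemidef k) v u
    rw [← hT] at h
    exact h.trans (mul_le_mul_of_nonneg_left hw hm0)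
  -- Cauchy–Schwarz for `1 − T`: `‖z₂‖² ≤ δ·⟨u−v|(1−T)|u−v⟩ ≤ δ·a`
  have hres : (star (u - v) ⬝ᵥ ((1 - T) *ᵥ (u - v))).re ≤ a := by
    rw [hT, E.dotProduct_one_sub_mulVec, Complex.sub_re]
    have hw0 : 0 ≤ (star (u - v) ⬝ᵥ (E.effect k *ᵥ (u - v))).re := E.weight_re_nonneg (u - v) k
    have hnn : (star (u - v) ⬝ᵥ (u - v)).re = a - ρ * a := by
      rw [star_sub, sub_dotProduct, dotProduct_sub, dotProduct_sub, hu, huv, hvu, hv]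
      simp only [Complex.sub_re, Complex.ofReal_re]
      ring
    rw [hnn]
    nlinarith
  have cs2 : ‖z₂‖ ^ 2 ≤ δ * a := by
    have h := norm_sq_dotProduct_mulVec_le (E.posSemidef_one_sub k) v (u - v)
    rw [← hT] at h
    exact h.trans (mul_le_mul_of_nonneg_left hres hδ0)
  -- numerics
  have hρa : 0 < ρ * a := mul_pos hρ ha
  have hm_le : m ≤ ρ * a := by linarith
  have b1 : ‖z₁‖ ^ 2 ≤ (a * ρ / 4) ^ 2 := by
    have : m * (ε * a) ≤ (ρ * a) * (ρ / 32 * a) := by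
      apply mul_le_mul hm_le (by nlinarith) (by nlinarith) hρa.le
    nlinarith
  have b2 : ‖z₂‖ ^ 2 ≤ (a * ρ / 4) ^ 2 := by
    have : δ * a ≤ (a * ρ ^ 2 / 16) * a := mul_le_mul_of_nonneg_right hcon ha.le
    nlinarith
  have hq : 0 ≤ a * ρ / 4 := by nlinarith
  have n1 : ‖z₁‖ ≤ a * ρ / 4 := by
    have h := abs_le_of_sq_le_sq b1 hq
    rwa [abs_of_nonneg (norm_nonneg _)] at h
  have n2 : ‖z₂‖ ≤ a * ρ / 4 := by
    have h := abs_le_of_sq_le_sq b2 hq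
    rwa [abs_of_nonneg (norm_nonneg _)] at h
  have hm_re : m = (z₁ + z₂).re := by rw [hm, hsplit]
  have hm_ub : m ≤ a * ρ / 2 := by
    rw [hm_re, Complex.add_re]
    have e1 := (abs_le.1 ((Complex.abs_re_le_norm z₁))).2
    have e2 := (abs_le.1 ((Complex.abs_re_le_norm z₂))).2
    linarith
  -- `m = ρa − δ ≥ ρa − aρ²/16 ≥ (15/16)ρa`, contradiction
  have hρρ : ρ ^ 2 ≤ ρ := by nlinarith
  nlinarith

omit [DecidableEq κ] in
/-- **Total defect.**  If `(O_j)` (norm² `a`, all with the `ε`-almost-certain outcome `k`) lies in the span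
of the orthogonal family `(u_v)` (norm² `a`), then `Σ_v ⟨P u_v|(1 − E_k)|P u_v⟩ = Σ_j ⟨O_j|(1 − E_k)|O_j⟩ ≤ ε·a·#J`.
[cite: NielsenChuang2010, §2.2.6 p. 90] -/
theorem total_defect_le {ε a : ℝ} {J V : Type*} [Fintype J] [DecidableEq J] [Fintype V] [DecidableEq V]
    (O : J → X → ℂ) (uf : V → X → ℂ) (ha : 0 < a)
    (hO : ∀ j j', star (O j) ⬝ᵥ O j' = if j = j' then ((a : ℂ)) else 0)
    (hX : ∀ j, O j = frameProj uf a (O j)) (k : κ) (hk : ∀ j, E.AlmostCertain ε (O j) k) :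
    ∑ v, (star (frameProj O a (uf v)) ⬝ᵥ ((1 - E.effect k) *ᵥ frameProj O a (uf v))).re
      ≤ ε * a * Fintype.card J := by
  rw [← Complex.re_sum, sum_star_frameProj_mulVec O uf ha hO hX (1 - E.effect k), Complex.re_sum]
  have hj : ∀ j, (star (O j) ⬝ᵥ ((1 - E.effect k) *ᵥ O j)).re ≤ ε * a := by
    intro j
    rw [E.dotProduct_one_sub_mulVec, Complex.sub_re, hO j j, if_pos rfl, Complex.ofReal_re]
    have h := hk j
    unfold AlmostCertain weight at h
    rw [hO j j, if_pos rfl, Complex.ofReal_re] at h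
    linarith
  calc ∑ j, (star (O j) ⬝ᵥ ((1 - E.effect k) *ᵥ O j)).re ≤ ∑ _j : J, ε * a :=
        Finset.sum_le_sum fun j _ => hj j
    _ = ε * a * Fintype.card J := by rw [Finset.sum_const, nsmul_eq_mul, Finset.card_univ]; ring

/-- **THE FRAME ENDGAME.**  Two orthogonal families `O⁰, O¹` (norm² `a`) on which a POVM `E` has the
`ε`-almost-certain outcomes `k₀` resp. `k₁`, a third orthogonal family `(u_v)` (norm² `a`) spanning both, and a
set `F` of indices `v` whose `u_v` has weight exactly `ρa` on each family's span and SOME almost-certain outcome.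
If `32ε ≤ ρ ≤ 1` and `32ε·#Oᶜ ≤ ρ²·#F` then `k₀ = k₁`: otherwise every `u_v`, `v ∈ F`, misses `k₀` or `k₁`,
so by `defect_lower_bound` its projection onto one of the two spans has defect `> aρ²/16`, while by the trace
identity the total defect over ALL `v` is `Σ_j ⟨O_j|(1 − E_{k_c})|O_j⟩ ≤ ε·a·#Oᶜ`.
[cite: NielsenChuang2010, §2.2.6 p. 90, Box 2.3 p. 87] -/
theorem frame_endgame {ε a ρ : ℝ} (ha : 0 < a) (hρ : 0 < ρ) (hρ1 : ρ ≤ 1) (hε : 32 * ε ≤ ρ)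
    {J₀ J₁ V : Type*} [Fintype J₀] [DecidableEq J₀] [Fintype J₁] [DecidableEq J₁] [Fintype V]
    [DecidableEq V] (O₀ : J₀ → X → ℂ) (O₁ : J₁ → X → ℂ) (uf : V → X → ℂ)
    (hO₀ : ∀ j j', star (O₀ j) ⬝ᵥ O₀ j' = if j = j' then ((a : ℂ)) else 0)
    (hO₁ : ∀ j j', star (O₁ j) ⬝ᵥ O₁ j' = if j = j' then ((a : ℂ)) else 0)
    (huf : ∀ v v', star (uf v) ⬝ᵥ uf v' = if v = v' then ((a : ℂ)) else 0)
    (hX₀ : ∀ j, O₀ j = frameProj uf a (O₀ j)) (hX₁ : ∀ j, O₁ j = frameProj uf a (O₁ j))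
    (F : Finset V) (hFne : F.Nonempty)
    (hM₀ : ∀ v ∈ F, ∑ j, ‖star (O₀ j) ⬝ᵥ uf v‖ ^ 2 = ρ * a ^ 2)
    (hM₁ : ∀ v ∈ F, ∑ j, ‖star (O₁ j) ⬝ᵥ uf v‖ ^ 2 = ρ * a ^ 2)
    {k₀ k₁ : κ} (hk₀ : ∀ j, E.AlmostCertain ε (O₀ j) k₀) (hk₁ : ∀ j, E.AlmostCertain ε (O₁ j) k₁)
    (hF : ∀ v ∈ F, ∃ k, E.AlmostCertain ε (uf v) k)
    (hc₀ : 32 * ε * (Fintype.card J₀ : ℝ) ≤ ρ ^ 2 * (F.card : ℝ))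
    (hc₁ : 32 * ε * (Fintype.card J₁ : ℝ) ≤ ρ ^ 2 * (F.card : ℝ)) :
    k₀ = k₁ := by
  by_contra hne
  -- the defects
  set δ₀ : V → ℝ := fun v =>
    (star (frameProj O₀ a (uf v)) ⬝ᵥ ((1 - E.effect k₀) *ᵥ frameProj O₀ a (uf v))).re with hδ₀
  set δ₁ : V → ℝ := fun v =>
    (star (frameProj O₁ a (uf v)) ⬝ᵥ ((1 - E.effect k₁) *ᵥ frameProj O₁ a (uf v))).re with hδ₁
  have hδ₀0 : ∀ v, 0 ≤ δ₀ v := fun v =>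
    (Complex.nonneg_iff.1 ((E.posSemidef_one_sub k₀).dotProduct_mulVec_nonneg _)).1
  have hδ₁0 : ∀ v, 0 ≤ δ₁ v := fun v =>
    (Complex.nonneg_iff.1 ((E.posSemidef_one_sub k₁).dotProduct_mulVec_nonneg _)).1
  have hufa : ∀ v, star (uf v) ⬝ᵥ uf v = ((a : ℂ)) := fun v => by rw [huf, if_pos rfl]
  have hufre : ∀ v, (star (uf v) ⬝ᵥ uf v).re = a := fun v => by rw [hufa, Complex.ofReal_re]
  -- weight of a missed outcome
  have hmiss : ∀ v k k', E.AlmostCertain ε (uf v) k → k ≠ k' → (E.weight (uf v) k').re ≤ ε * a := by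
    intro v k k' hk hkk
    have h2 := E.weight_re_add_weight_re_le (uf v) hkk
    unfold AlmostCertain at hk
    rw [hufre] at hk h2
    linarith
  -- Step 1: every `v ∈ F` has a large defect on one side
  have step1 : ∀ v ∈ F, a * ρ ^ 2 / 16 < δ₀ v + δ₁ v := by
    intro v hv
    obtain ⟨k, hk⟩ := hF v hv
    have hP₀ : star (frameProj O₀ a (uf v)) ⬝ᵥ frameProj O₀ a (uf v) = (((ρ * a : ℝ)) : ℂ) := by
      rw [star_frameProj_self O₀ ha hO₀, hM₀ v hv]
      congr 1
      field_simp
    have hP₁ : star (frameProj O₁ a (uf v)) ⬝ᵥ frameProj O₁ a (uf v) = (((ρ * a : ℝ)) : ℂ) := by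
      rw [star_frameProj_self O₁ ha hO₁, hM₁ v hv]
      congr 1
      field_simp
    by_cases hk0 : k = k₀
    · have hk1 : k ≠ k₁ := fun h => hne (hk0.symm.trans h)
      have hd := E.defect_lower_bound k₁ ha hρ hρ1 hε (hufa v) hP₁
        (star_frameProj_dotProduct_sub O₁ ha hO₁ (uf v)) (hmiss v k k₁ hk hk1)
      have := hδ₀0 v
      show a * ρ ^ 2 / 16 < δ₀ v + δ₁ v
      linarith
    · have hd := E.defect_lower_bound k₀ ha hρ hρ1 hε (hufa v) hP₀
        (star_frameProj_dotProduct_sub O₀ ha hO₀ (uf v)) (hmiss v k k₀ hk hk0)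
      have := hδ₁0 v
      show a * ρ ^ 2 / 16 < δ₀ v + δ₁ v
      linarith
  -- Step 2: sum over `F`
  have step2 : (F.card : ℝ) * (a * ρ ^ 2 / 16) < ∑ v ∈ F, (δ₀ v + δ₁ v) := by
    have h := Finset.sum_lt_sum_of_nonempty hFne step1
    rwa [Finset.sum_const, nsmul_eq_mul] at h
  -- Step 3: the total defect of each side is at most `ε·a·#J`
  have t₀ := E.total_defect_le O₀ uf ha hO₀ hX₀ k₀ hk₀
  have t₁ := E.total_defect_le O₁ uf ha hO₁ hX₁ k₁ hk₁
  have s₀ : ∑ v ∈ F, δ₀ v ≤ ∑ v, δ₀ v := Finset.sum_le_univ_sum_of_nonneg hδ₀0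
  have s₁ : ∑ v ∈ F, δ₁ v ≤ ∑ v, δ₁ v := Finset.sum_le_univ_sum_of_nonneg hδ₁0
  rw [Finset.sum_add_distrib] at step2
  have hc₀' : ε * a * (Fintype.card J₀ : ℝ) ≤ ρ ^ 2 * (F.card : ℝ) * a / 32 := by nlinarith
  have hc₁' : ε * a * (Fintype.card J₁ : ℝ) ≤ ρ ^ 2 * (F.card : ℝ) * a / 32 := by nlinarith
  have e₀ : ∑ v, δ₀ v ≤ ε * a * Fintype.card J₀ := t₀
  have e₁ : ∑ v, δ₁ v ≤ ε * a * Fintype.card J₁ := t₁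
  linarith

end POVM

/-! ## Part III.  Lines and boxes in `ℤ_Q × ℤ_Qⁿ`; the constrained character sum -/

section Box

variable {Q : ℕ} [NeZero Q] {n : ℕ}

/-- The LINE of modulus `A` through `c`: `{e ∈ ℤ_Q : A·(e − c) = 0} = c + (Q/A)·ℤ_Q` (`A = 1`: the point `c`;
`A = Q`: all of `ℤ_Q`). [folklore] -/
def lineSet (A : ℕ) (c : ZMod Q) : Finset (ZMod Q) := Finset.univ.filter fun e => (A : ZMod Q) * (e - c) = 0

/-- Membership in a line. [folklore] -/
theorem mem_lineSet {A : ℕ} {c e : ZMod Q} : e ∈ lineSet A c ↔ (A : ZMod Q) * (e - c) = 0 := by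
  simp [lineSet]

/-- `#line_A(c) = A` for `A ∣ Q`. [folklore] -/
theorem card_lineSet {A C : ℕ} (hQ : Q = A * C) (c : ZMod Q) : (lineSet A c).card = A := by
  calc (lineSet A c).card = (Finset.univ.filter fun r : ZMod Q => (A : ZMod Q) * r = 0).card :=
        Finset.card_equiv (Equiv.subRight c) fun e => by simp [lineSet]
    _ = A := card_filter_ann hQ

/-- The SPIKE weight vector: `A` at `τ`, `1` elsewhere. [folklore] -/
def spike (τ : Fin n) (A : ℕ) : Fin n → ℕ := fun t => if t = τ then A else 1

/-- The spike at its own coordinate. [folklore] -/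
@[simp] theorem spike_self (τ : Fin n) (A : ℕ) : spike τ A τ = A := by simp [spike]

/-- The spike off its coordinate is `1`. [folklore] -/
theorem spike_of_ne {τ t : Fin n} (A : ℕ) (ht : t ≠ τ) : spike τ A t = 1 := by simp [spike, ht]

omit [NeZero Q] in
/-- `∀ t, spike_τ(A)_t·r_t = 0` means `A·r_τ = 0` and `r_t = 0` off `τ`. [folklore] -/
theorem forall_spike_mul_eq_zero_iff (τ : Fin n) (A : ℕ) (r : Fin n → ZMod Q) :
    (∀ t, ((spike τ A t : ℕ) : ZMod Q) * r t = 0) ↔ ((A : ZMod Q) * r τ = 0 ∧ ∀ t, t ≠ τ → r t = 0) := by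
  constructor
  · intro hr
    refine ⟨by simpa using hr τ, fun t ht => ?_⟩
    have := hr t
    rwa [spike_of_ne A ht, Nat.cast_one, one_mul] at this
  · rintro ⟨hτ, hoff⟩ t
    by_cases ht : t = τ
    · subst ht; simpa using hτ
    · rw [spike_of_ne A ht, Nat.cast_one, one_mul, hoff t ht]

/-- The BOX `line_A(x) × Π_t line_{g_t}(w_t) ⊆ ℤ_Q × ℤ_Qⁿ`. [folklore] -/
def box (A : ℕ) (g : Fin n → ℕ) (x : ZMod Q) (w : Fin n → ZMod Q) : Finset (ZMod Q × (Fin n → ZMod Q)) :=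
  lineSet A x ×ˢ Fintype.piFinset fun t => lineSet (g t) (w t)

/-- Membership in a box, coordinatewise. [folklore] -/
theorem mem_box {A : ℕ} {g : Fin n → ℕ} {x : ZMod Q} {w : Fin n → ZMod Q} {v : ZMod Q × (Fin n → ZMod Q)} :
    v ∈ box A g x w ↔ (A : ZMod Q) * (v.1 - x) = 0 ∧ ∀ t, (g t : ZMod Q) * (v.2 t - w t) = 0 := by
  simp [box, lineSet, Finset.mem_product, Fintype.mem_piFinset]

/-- Box membership is symmetric in centre and point. [folklore] -/
theorem mem_box_comm {A : ℕ} {g : Fin n → ℕ} {v j : ZMod Q × (Fin n → ZMod Q)} :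
    j ∈ box A g v.1 v.2 ↔ v ∈ box A g j.1 j.2 := by
  rw [mem_box, mem_box]
  have key : ∀ (a b c : ZMod Q), a * (b - c) = 0 ↔ a * (c - b) = 0 := fun a b c => by
    constructor <;> intro h <;> linear_combination (-1 : ZMod Q) * h
  rw [key]
  exact and_congr Iff.rfl (forall_congr' fun t => key _ _ _)

/-- The centre lies in its box. [folklore] -/
theorem self_mem_box (A : ℕ) (g : Fin n → ℕ) (x : ZMod Q) (w : Fin n → ZMod Q) : (x, w) ∈ box A g x w := by
  simp [mem_box]

/-- `#box = A·Π_t g_t` when all moduli divide `Q`. [folklore] -/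
theorem card_box {A : ℕ} {g : Fin n → ℕ} (hA : A ∣ Q) (hg : ∀ t, g t ∣ Q) (x : ZMod Q) (w : Fin n → ZMod Q) :
    (box A g x w).card = A * ∏ t, g t := by
  obtain ⟨C, hC⟩ := hA
  rw [box, Finset.card_product, Fintype.card_piFinset, card_lineSet hC]
  congr 1
  exact Finset.prod_congr rfl fun t _ => by obtain ⟨C', hC'⟩ := hg t; exact card_lineSet hC' _

/-- Intersecting two boxes coordinatewise. [folklore] -/
theorem box_inter_box_eq {A A' : ℕ} {g g' : Fin n → ℕ} {x x' : ZMod Q} {w w' : Fin n → ZMod Q}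
    (g'' : Fin n → ℕ) (w'' : Fin n → ZMod Q)
    (hx : ∀ e, (A : ZMod Q) * (e - x) = 0 → (A' : ZMod Q) * (e - x') = 0)
    (ht : ∀ t e, ((g t : ZMod Q) * (e - w t) = 0 ∧ (g' t : ZMod Q) * (e - w' t) = 0)
      ↔ (g'' t : ZMod Q) * (e - w'' t) = 0) :
    box A g x w ∩ box A' g' x' w' = box A g'' x w'' := by
  ext ⟨e, f⟩
  simp only [Finset.mem_inter, mem_box]
  constructor
  · rintro ⟨⟨h1, h2⟩, -, h4⟩
    exact ⟨h1, fun t => (ht t _).1 ⟨h2 t, h4 t⟩⟩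
  · rintro ⟨h1, h2⟩
    exact ⟨⟨h1, fun t => ((ht t _).2 (h2 t)).1⟩, hx _ h1, fun t => ((ht t _).2 (h2 t)).2⟩

/-- **The coset character sum:** `‖Σ_{e : e·G′ = Δ} ψ_Q(e·d)‖ = G′·[H′Δ = 0 ∧ H′d = 0]` for `Q = G′H′` (the
constraint set is empty unless `Δ ∈ G′ℤ_Q`, and then it is a coset of `H′ℤ_Q = ker(·G′)`, on which `ψ_Q(·d)`
sums to `G′·[H′d = 0]` up to a phase). [folklore] -/
theorem norm_sum_coset_stdAddChar {G' H' : ℕ} (hQ : Q = G' * H') (Δ d : ZMod Q) :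
    ‖∑ e : ZMod Q, (if e * (G' : ZMod Q) = Δ then (ZMod.stdAddChar (e * d) : ℂ) else 0)‖
      = if (H' : ZMod Q) * Δ = 0 ∧ (H' : ZMod Q) * d = 0 then ((G' : ℝ)) else 0 := by
  have hψ : ∀ a : ZMod Q, ‖(ZMod.stdAddChar a : ℂ)‖ = 1 := fun a => by
    rw [ZMod.stdAddChar_apply, Circle.norm_coe]
  have hQ' : Q = H' * G' := by rw [hQ, mul_comm]
  have hGH : (G' : ZMod Q) * (H' : ZMod Q) = 0 := by
    rw [← Nat.cast_mul, ← hQ, ZMod.natCast_self]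
  by_cases hΔ : (H' : ZMod Q) * Δ = 0
  · -- `Δ = G′·m`
    obtain ⟨m, hm⟩ := (natCast_mul_eq_zero_iff hQ' Δ).1 hΔ
    have hΔeq : Δ = (m : ZMod Q) * (G' : ZMod Q) := by
      rw [← ZMod.natCast_zmod_val Δ, hm, Nat.cast_mul, mul_comm]
    set e₀ : ZMod Q := (m : ZMod Q) with he₀
    -- reindex `e ↦ e + e₀`
    rw [← Equiv.sum_comp (Equiv.addRight e₀)]
    simp only [Equiv.coe_addRight]
    have hterm : ∀ e : ZMod Q, (if (e + e₀) * (G' : ZMod Q) = Δ then (ZMod.stdAddChar ((e + e₀) * d) : ℂ) else 0)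
        = (ZMod.stdAddChar (e₀ * d) : ℂ) * (if (G' : ZMod Q) * e = 0 then (ZMod.stdAddChar (d * e) : ℂ) else 0) := by
      intro e
      have hc : (e + e₀) * (G' : ZMod Q) = Δ ↔ (G' : ZMod Q) * e = 0 := by
        rw [hΔeq]
        constructor
        · intro h; linear_combination h
        · intro h; linear_combination h
      by_cases he : (G' : ZMod Q) * e = 0
      · rw [if_pos (hc.2 he), if_pos he, add_mul, AddChar.map_add_eq_mul, mul_comm e d]
        exact mul_comm _ _
      · rw [if_neg (fun h => he (hc.1 h)), if_neg he, mul_zero]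
    simp_rw [hterm]
    rw [← Finset.mul_sum, ← Finset.sum_filter, sum_filter_ann_stdAddChar hQ d, norm_mul, hψ, one_mul]
    by_cases hd : (H' : ZMod Q) * d = 0
    · rw [if_pos hd, if_pos ⟨hΔ, hd⟩, Complex.norm_natCast]
    · rw [if_neg hd, if_neg (fun h => hd h.2), norm_zero]
  · -- no `e` satisfies the constraint
    have hnone : ∀ e : ZMod Q, ¬ (e * (G' : ZMod Q) = Δ) := by
      intro e he
      apply hΔ
      rw [← he]
      linear_combination e * hGH
    rw [Finset.sum_eq_zero (fun e _ => if_neg (hnone e)), norm_zero, if_neg (fun h => hΔ h.1)]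

/-- **The constrained character sum over `ℤ_Qⁿ`:**
`‖Σ_{η : η_τ·G′ = Δ} ψ_Q(⟨η,d⟩)‖ = G′·Q^{n−1}·[H′Δ = 0 ∧ H′d_τ = 0 ∧ d_t = 0 (t ≠ τ)]`. [folklore] -/
theorem norm_sum_spike_stdAddChar {G' H' : ℕ} (hQ : Q = G' * H') (τ : Fin n) (Δ : ZMod Q)
    (d : Fin n → ZMod Q) :
    ‖∑ η : Fin n → ZMod Q, (if η τ * (G' : ZMod Q) = Δ then (ZMod.stdAddChar (∑ t, η t * d t) : ℂ) else 0)‖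
      = if (H' : ZMod Q) * Δ = 0 ∧ ∀ t, ((spike τ H' t : ℕ) : ZMod Q) * d t = 0
        then ((G' : ℝ)) * ∏ _t ∈ Finset.univ.erase τ, ((Q : ℝ)) else 0 := by
  classical
  -- the per-coordinate factors
  set g : Fin n → ZMod Q → ℂ := fun t e =>
    if t = τ then (if e * (G' : ZMod Q) = Δ then (ZMod.stdAddChar (e * d t) : ℂ) else 0)
    else (ZMod.stdAddChar (e * d t) : ℂ) with hg
  have hprodψ : ∀ η : Fin n → ZMod Q,
      (ZMod.stdAddChar (∑ t, η t * d t) : ℂ) = ∏ t, (ZMod.stdAddChar (η t * d t) : ℂ) := fun η =>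
    stdAddChar_sum_eq_prod Finset.univ fun t => η t * d t
  have hterm : ∀ η : Fin n → ZMod Q,
      (if η τ * (G' : ZMod Q) = Δ then (ZMod.stdAddChar (∑ t, η t * d t) : ℂ) else 0) = ∏ t, g t (η t) := by
    intro η
    rw [← Finset.mul_prod_erase Finset.univ (fun t => g t (η t)) (Finset.mem_univ τ)]
    have hoff : ∏ t ∈ Finset.univ.erase τ, g t (η t) = ∏ t ∈ Finset.univ.erase τ, (ZMod.stdAddChar (η t * d t) : ℂ) :=
      Finset.prod_congr rfl fun t ht => by rw [hg]; simp only [if_neg (Finset.ne_of_mem_erase ht)]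
    rw [hoff]
    have hgτ : g τ (η τ) = if η τ * (G' : ZMod Q) = Δ then (ZMod.stdAddChar (η τ * d τ) : ℂ) else 0 := by
      rw [hg]; simp only [if_true]
    rw [hgτ]
    by_cases hc : η τ * (G' : ZMod Q) = Δ
    · rw [if_pos hc, if_pos hc, hprodψ, ← Finset.mul_prod_erase Finset.univ _ (Finset.mem_univ τ)]
    · rw [if_neg hc, if_neg hc, zero_mul]
  simp_rw [hterm]
  rw [← Fintype.piFinset_univ, ← Finset.prod_univ_sum (fun _ => (Finset.univ : Finset (ZMod Q))) g,
    ← Finset.mul_prod_erase Finset.univ (fun t => ∑ e, g t e) (Finset.mem_univ τ)]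
  have hoff : ∏ t ∈ Finset.univ.erase τ, (∑ e, g t e)
      = ∏ t ∈ Finset.univ.erase τ, (if d t = 0 then ((Q : ℂ)) else 0) := by
    refine Finset.prod_congr rfl fun t ht => ?_
    have hne := Finset.ne_of_mem_erase ht
    rw [← sum_stdAddChar_mul_eq (d t)]
    refine Finset.sum_congr rfl fun e _ => ?_
    rw [hg]; simp only [if_neg hne, mul_comm e (d t)]
  have hgτ : ∑ e, g τ e = ∑ e : ZMod Q, (if e * (G' : ZMod Q) = Δ then (ZMod.stdAddChar (e * d τ) : ℂ) else 0) :=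
    Finset.sum_congr rfl fun e _ => by rw [hg]; simp only [if_true]
  rw [hoff, hgτ, norm_mul, norm_sum_coset_stdAddChar hQ Δ (d τ), Finset.prod_ite_zero, apply_ite norm, norm_zero,
    norm_prod]
  simp only [Complex.norm_natCast]
  have hiff := forall_spike_mul_eq_zero_iff τ H' d
  by_cases h1 : (H' : ZMod Q) * Δ = 0 ∧ (H' : ZMod Q) * d τ = 0
  · by_cases h2 : ∀ t ∈ Finset.univ.erase τ, d t = 0
    · rw [if_pos h1, if_pos h2,
        if_pos ⟨h1.1, hiff.2 ⟨h1.2, fun t ht => h2 t (Finset.mem_erase.2 ⟨ht, Finset.mem_univ t⟩)⟩⟩]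
    · rw [if_pos h1, if_neg h2, mul_zero, if_neg]
      rintro ⟨-, h3⟩
      exact h2 fun t ht => (hiff.1 h3).2 t (Finset.ne_of_mem_erase ht)
  · rw [if_neg h1, zero_mul, if_neg]
    rintro ⟨h3, h4⟩
    exact h1 ⟨h3, (hiff.1 h4).1⟩

omit [NeZero Q] in
/-- `(Π_{t ≠ τ} Q)·Q = Qⁿ`. [folklore] -/
theorem prod_erase_const_mul (τ : Fin n) (q : ℝ) : (∏ _t ∈ Finset.univ.erase τ, q) * q = q ^ n := by
  rw [Finset.prod_erase_mul Finset.univ (fun _ => q) (Finset.mem_univ τ), Finset.prod_const, Finset.card_univ,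
    Fintype.card_fin]

end Box

/-! ### Orbit boxes and the test-box count -/

section OrbitBox

variable {Q : ℕ} [NeZero Q] {n : ℕ}

/-- The ORBIT MODULI: `H₀` on the unknown coordinates `T`, `1` (no movement) elsewhere. [folklore] -/
def orbW (T : Finset (Fin n)) (H₀ : ℕ) : Fin n → ℕ := fun t => if t ∈ T then H₀ else 1

/-- Orbit modulus on an unknown coordinate. [folklore] -/
@[simp] theorem orbW_of_mem {T : Finset (Fin n)} (H₀ : ℕ) {t : Fin n} (ht : t ∈ T) : orbW T H₀ t = H₀ :=
  if_pos ht

/-- Orbit modulus on a known coordinate. [folklore] -/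
@[simp] theorem orbW_of_not_mem {T : Finset (Fin n)} (H₀ : ℕ) {t : Fin n} (ht : t ∉ T) :
    orbW T H₀ t = 1 :=
  if_neg ht

omit [NeZero Q] in
/-- The orbit moduli divide `Q` when `H₀ ∣ Q`. [folklore] -/
theorem orbW_dvd {T : Finset (Fin n)} {H₀ : ℕ} (hH₀ : H₀ ∣ Q) (t : Fin n) : orbW T H₀ t ∣ Q := by
  by_cases ht : t ∈ T
  · rw [orbW_of_mem H₀ ht]; exact hH₀
  · rw [orbW_of_not_mem H₀ ht]; exact one_dvd _

/-- `#(test box) = p²·#(orbit box)` when `H′ = p·H₀`: the test box has modulus `H′` in the `x`-slot and at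
`τ`, the orbit box `H₀`. [folklore] -/
theorem card_testBox {p H₀ H' : ℕ} (hH : H' = p * H₀) (hH'Q : H' ∣ Q) {T : Finset (Fin n)} {τ : Fin n}
    (hτ : τ ∈ T) (x₁ xc : ZMod Q) (w₁ wc : Fin n → ZMod Q) :
    ((box H' (Function.update (orbW T H₀) τ H') x₁ w₁).card : ℝ)
      = (p : ℝ) ^ 2 * (box H₀ (orbW T H₀) xc wc).card := by
  have hH₀Q : H₀ ∣ Q := dvd_trans (Dvd.intro_left p hH.symm) hH'Q
  have hg' : ∀ t, Function.update (orbW T H₀) τ H' t ∣ Q := fun t => by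
    rcases eq_or_ne t τ with rfl | ht
    · rw [Function.update_self]; exact hH'Q
    · rw [Function.update_of_ne ht]; exact orbW_dvd hH₀Q t
  rw [card_box hH'Q hg', card_box hH₀Q (orbW_dvd hH₀Q), Finset.prod_update_of_mem (Finset.mem_univ τ),
    Finset.prod_eq_mul_prod_sdiff_singleton_of_mem (Finset.mem_univ τ) (orbW T H₀), orbW_of_mem H₀ hτ, hH]
  push_cast
  ring

end OrbitBox

/-! ## Part IV.  The straightened class members, the test vectors, and their exact overlaps -/

namespace Shape

variable (S : Shape)

/-- The tail slopes mod `Q`: `b̄_t := b_{t+1} (mod Q)`. [cite: ChenQuantumLattice2024, Cond. C.3 p. 18] -/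
def bbar : Fin S.n → ZMod S.Q := fun t => ((S.b t.succ : ℤ) : ZMod S.Q)

/-- `2p₁·(b_{t+1}/(2p₁)) = b̄_t (mod Q)` for admissible `S`. [cite: ChenQuantumLattice2024, Cond. C.3 p. 18] -/
theorem two_p₁_mul_bhalf (h : S.Admissible) (t : Fin S.n) :
    (2 * ((S.p₁ : ℕ) : ZMod S.Q)) * (((S.b t.succ / (2 * (S.p₁ : ℤ)) : ℤ)) : ZMod S.Q) = S.bbar t := by
  have hz : (2 * (S.p₁ : ℤ)) * (S.b t.succ / (2 * (S.p₁ : ℤ))) = S.b t.succ :=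
    Int.mul_ediv_cancel' (h.b_tail t.succ (Fin.succ_ne_zero t))
  have hc := congrArg (Int.cast : ℤ → ZMod S.Q) hz
  push_cast at hc
  rw [bbar, ← hc]

/-- The STRAIGHTENED class member `Z_{x,w} := |u_{0; x, w − x·b̄}⟩`: in the coordinates `(x, w)` the shift
`v′ ↦ v′ + 2D²p₁·b` reads `(x, w) ↦ (x − 1, w)`, and overlaps with the test vectors depend on `w − w′` only.
[cite: ChenQuantumLattice2024, eq. (35) p. 31, §3.5.8 pp. 33–34] -/
noncomputable def zKet (x : ZMod S.Q) (w : Fin S.n → ZMod S.Q) : (Fin (S.n + 1) → ZMod S.M) → ℂ :=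
  S.uKet 0 x (w - x • S.bbar)

/-- The TEST VECTOR at coordinate `τ` with dummy slope `G′·e_τ`: `u^τ_{x′,w′} := |u_{G′e_τ; x′, w′ − x′·b̄}⟩`
(a class member whenever `τ+1 ∈ U`). [cite: ChenQuantumLattice2024, §3.1 p. 22, eq. (35) p. 31] -/
noncomputable def tKet (τ : Fin S.n) (G' : ℕ) (x : ZMod S.Q) (w : Fin S.n → ZMod S.Q) :
    (Fin (S.n + 1) → ZMod S.M) → ℂ :=
  S.uKet (Pi.single τ ((G' : ℕ) : ZMod S.Q)) x (w - x • S.bbar)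

/-- The straightened members are pairwise orthogonal of norm² `ν/Qⁿ`. [folklore] -/
theorem star_zKet_dotProduct_zKet (h : S.Admissible) (x x' : ZMod S.Q) (w w' : Fin S.n → ZMod S.Q) :
    star (S.zKet x w) ⬝ᵥ S.zKet x' w'
      = if x = x' ∧ w = w' then (((S.frameNormSq / ((S.Q : ℕ) : ℝ) ^ S.n : ℝ)) : ℂ) else 0 := by
  unfold zKet
  rw [S.star_uKet_dotProduct_uKet_same h]
  by_cases hx : x = x'
  · subst hx
    by_cases hw : w = w'
    · subst hw; rw [if_pos ⟨rfl, rfl⟩, if_pos ⟨rfl, rfl⟩]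
    · rw [if_neg, if_neg (fun h' => hw h'.2)]
      rintro ⟨-, h2⟩
      exact hw (sub_left_injective h2)
  · rw [if_neg (fun h' => hx h'.1), if_neg (fun h' => hx h'.1)]

/-- The test vectors (fixed `τ, G′`) are pairwise orthogonal of norm² `ν/Qⁿ`. [folklore] -/
theorem star_tKet_dotProduct_tKet (h : S.Admissible) (τ : Fin S.n) (G' : ℕ) (x x' : ZMod S.Q)
    (w w' : Fin S.n → ZMod S.Q) :
    star (S.tKet τ G' x w) ⬝ᵥ S.tKet τ G' x' w'
      = if x = x' ∧ w = w' then (((S.frameNormSq / ((S.Q : ℕ) : ℝ) ^ S.n : ℝ)) : ℂ) else 0 := by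
  unfold tKet
  rw [S.star_uKet_dotProduct_uKet_same h]
  by_cases hx : x = x'
  · subst hx
    by_cases hw : w = w'
    · subst hw; rw [if_pos ⟨rfl, rfl⟩, if_pos ⟨rfl, rfl⟩]
    · rw [if_neg, if_neg (fun h' => hw h'.2)]
      rintro ⟨-, h2⟩
      exact hw (sub_left_injective h2)
  · rw [if_neg (fun h' => hx h'.1), if_neg (fun h' => hx h'.1)]

/-- The product of coefficients of a straightened member and a test vector on a common block `η` with
`⟨η, β⟩ = x − x′`: `Q⁻²ⁿ·ψ_Q(p₁(x − x′)²)·ψ_Q(⟨η, w − w′⟩)` — the `b̄`-twist cancels exactly.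
[cite: ChenQuantumLattice2024, eq. (35) p. 31, §3.5.8 p. 34] -/
theorem conj_coefOf_zero_mul_coefOf (h : S.Admissible) (β : Fin S.n → ZMod S.Q) (x x' : ZMod S.Q)
    (w w' η : Fin S.n → ZMod S.Q) (hc : ∑ t, η t * β t = x - x') :
    (starRingEnd ℂ) (S.coefOf Finset.univ 0 x (w - x • S.bbar) η)
        * S.coefOf Finset.univ β x' (w' - x' • S.bbar) η
      = (1 / ((S.Q : ℕ) : ℂ) ^ S.n) ^ 2 * ((ZMod.stdAddChar (((S.p₁ : ℕ) : ZMod S.Q) * (x - x') ^ 2) : ℂ)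
          * ZMod.stdAddChar (∑ t, η t * (w t - w' t))) := by
  rw [S.conj_coefOf, coefOf, S.sig_BfamT, S.sig_BfamT]
  simp only [Pi.zero_apply, mul_zero, Finset.sum_const_zero, add_zero]
  rw [hc]
  set σ := S.sig (fun t => S.b t.succ / (2 * (S.p₁ : ℤ))) η with hσ
  have hσ' : σ = ∑ t, η t * (((S.b t.succ / (2 * (S.p₁ : ℤ)) : ℤ)) : ZMod S.Q) := rfl
  have key : ∑ t, η t * (w - x • S.bbar) t - ∑ t, η t * (w' - x' • S.bbar) t
      + 2 * ((S.p₁ : ℕ) : ZMod S.Q) * (x - x') * σ = ∑ t, η t * (w t - w' t) := by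
    rw [hσ', Finset.mul_sum, ← Finset.sum_sub_distrib, ← Finset.sum_add_distrib]
    refine Finset.sum_congr rfl fun t _ => ?_
    rw [Pi.sub_apply, Pi.sub_apply, Pi.smul_apply, Pi.smul_apply, smul_eq_mul, smul_eq_mul,
      ← S.two_p₁_mul_bhalf h t]
    ring
  have hexp : ∑ t, η t * (w - x • S.bbar) t
      + (2 * ((S.p₁ : ℕ) : ZMod S.Q) * x * σ + ((S.p₁ : ℕ) : ZMod S.Q) * x ^ 2)
      + (-(∑ t, η t * (w' - x' • S.bbar) t)
        + (-(2 * ((S.p₁ : ℕ) : ZMod S.Q) * x' * (σ + (x - x'))) - ((S.p₁ : ℕ) : ZMod S.Q) * x' ^ 2))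
      = ((S.p₁ : ℕ) : ZMod S.Q) * (x - x') ^ 2 + ∑ t, η t * (w t - w' t) := by
    linear_combination key
  rw [show ∀ a b c d : ZMod S.Q, (1 / ((S.Q : ℕ) : ℂ) ^ S.n) * ((ZMod.stdAddChar a : ℂ) * ZMod.stdAddChar b)
      * ((1 / ((S.Q : ℕ) : ℂ) ^ S.n) * (ZMod.stdAddChar c * ZMod.stdAddChar d))
      = (1 / ((S.Q : ℕ) : ℂ) ^ S.n) ^ 2 * ZMod.stdAddChar (a + b + (c + d)) from fun a b c d => by
        rw [AddChar.map_add_eq_mul, AddChar.map_add_eq_mul, AddChar.map_add_eq_mul]; ring,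
    hexp, AddChar.map_add_eq_mul]

/-- **The overlap of a straightened member with a test vector** (value): only the blocks `η` with
`η_τ·G′ = x − x′` contribute, each `Q⁻²ⁿ ψ(p₁(x−x′)²)·ν·ψ(⟨η, w − w′⟩)`.
[cite: ChenQuantumLattice2024, eq. (35) p. 31, §3.5.8 pp. 33–34] -/
theorem star_zKet_dotProduct_tKet (h : S.Admissible) (τ : Fin S.n) (G' : ℕ) (x x' : ZMod S.Q)
    (w w' : Fin S.n → ZMod S.Q) :
    star (S.zKet x w) ⬝ᵥ S.tKet τ G' x' w'
      = (1 / ((S.Q : ℕ) : ℂ) ^ S.n) ^ 2 * (ZMod.stdAddChar (((S.p₁ : ℕ) : ZMod S.Q) * (x - x') ^ 2) : ℂ)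
          * ((S.frameNormSq : ℝ) : ℂ)
          * ∑ η : Fin S.n → ZMod S.Q, (if η τ * (G' : ZMod S.Q) = x - x'
              then (ZMod.stdAddChar (∑ t, η t * (w - w') t) : ℂ) else 0) := by
  unfold zKet tKet
  rw [S.star_uKet_dotProduct_uKet h, Finset.mul_sum]
  refine Finset.sum_congr rfl fun η _ => ?_
  have h2 : ∑ t, η t * (Pi.single τ ((G' : ℕ) : ZMod S.Q) : Fin S.n → ZMod S.Q) t
      = η τ * (G' : ZMod S.Q) := by
    rw [Finset.sum_eq_single τ (fun t _ ht => by rw [Pi.single_eq_of_ne ht, mul_zero])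
      (fun hτ => absurd (Finset.mem_univ τ) hτ), Pi.single_eq_same]
  have hcond : S.mOf Finset.univ 0 x η = S.mOf Finset.univ (Pi.single τ ((G' : ℕ) : ZMod S.Q)) x' η
      ↔ η τ * (G' : ZMod S.Q) = x - x' := by
    rw [S.mOf_eq_mOf_iff h]
    simp only [Pi.zero_apply, mul_zero, Finset.sum_const_zero, add_zero]
    rw [h2]
    constructor
    · intro he; linear_combination -he
    · intro he; linear_combination -he
  by_cases hc : η τ * (G' : ZMod S.Q) = x - x'
  · have hc' : ∑ t, η t * (Pi.single τ ((G' : ℕ) : ZMod S.Q) : Fin S.n → ZMod S.Q) t = x - x' := by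
      rw [h2]; exact hc
    rw [if_pos (hcond.2 hc), if_pos hc, ← mul_assoc, S.conj_coefOf_zero_mul_coefOf h _ x x' w w' η hc']
    simp only [Pi.sub_apply]
    ring
  · rw [if_neg (fun h' => hc (hcond.1 h')), if_neg hc, mul_zero]

/-- **The exact overlap formula:** for `Q = G′H′`,
`‖⟨Z_{x,w} | u^τ_{x′,w′}⟩‖² = (ν/Qⁿ/H′)²·[H′(x − x′) = 0 ∧ H′(w_τ − w′_τ) = 0 ∧ w_t = w′_t (t ≠ τ)]`.
[cite: ChenQuantumLattice2024, eq. (35) p. 31, §3.5.8 pp. 33–34] -/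
theorem normSq_zKet_tKet (h : S.Admissible) {G' H' : ℕ} (hQ : (S.Q : ℕ) = G' * H') (τ : Fin S.n)
    (x x' : ZMod S.Q) (w w' : Fin S.n → ZMod S.Q) :
    ‖star (S.zKet x w) ⬝ᵥ S.tKet τ G' x' w'‖ ^ 2
      = if (H' : ZMod S.Q) * (x - x') = 0 ∧ ∀ t, ((spike τ H' t : ℕ) : ZMod S.Q) * (w t - w' t) = 0
        then (S.frameNormSq / ((S.Q : ℕ) : ℝ) ^ S.n / H') ^ 2 else 0 := by
  have hψ : ∀ a : ZMod S.Q, ‖(ZMod.stdAddChar a : ℂ)‖ = 1 := fun a => by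
    rw [ZMod.stdAddChar_apply, Circle.norm_coe]
  have hQr : ((S.Q : ℕ) : ℝ) = (G' : ℝ) * H' := by exact_mod_cast hQ
  have hQ0 : ((S.Q : ℕ) : ℝ) ≠ 0 := by exact_mod_cast S.Q.ne_zero
  have hH0 : (H' : ℝ) ≠ 0 := by exact_mod_cast (pos_right_of_eq_mul hQ).ne'
  have hν : 0 ≤ S.frameNormSq := S.frameNormSq_pos.le
  have hsum := norm_sum_spike_stdAddChar hQ τ (x - x') (w - w')
  simp only [Pi.sub_apply] at hsum
  rw [S.star_zKet_dotProduct_tKet h, norm_mul, norm_mul, norm_mul, hψ, mul_one, Complex.norm_real,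
    Real.norm_of_nonneg hν, norm_pow, norm_div, norm_one, norm_pow, Complex.norm_natCast]
  simp only [Pi.sub_apply]
  rw [hsum]
  by_cases hc : (H' : ZMod S.Q) * (x - x') = 0 ∧ ∀ t, ((spike τ H' t : ℕ) : ZMod S.Q) * (w t - w' t) = 0
  · rw [if_pos hc, if_pos hc]
    have hR : (∏ _t ∈ Finset.univ.erase τ, ((S.Q : ℕ) : ℝ)) = ((S.Q : ℕ) : ℝ) ^ S.n / ((S.Q : ℕ) : ℝ) := by
      rw [eq_div_iff hQ0, prod_erase_const_mul]
    have hG : (G' : ℝ) = ((S.Q : ℕ) : ℝ) / H' := by rw [eq_div_iff hH0, hQr]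
    rw [hR, hG]
    field_simp
  · rw [if_neg hc, if_neg hc, mul_zero, zero_pow two_ne_zero]

/-- The overlap formula in box form: `‖⟨Z_j | u^τ_v⟩‖² = (ν/Qⁿ/H′)²·[j ∈ box_{H′, spike_τ H′}(v)]`.
[cite: ChenQuantumLattice2024, eq. (35) p. 31, §3.5.8 pp. 33–34] -/
theorem normSq_zKet_tKet_box (h : S.Admissible) {G' H' : ℕ} (hQ : (S.Q : ℕ) = G' * H') (τ : Fin S.n)
    (j v : ZMod S.Q × (Fin S.n → ZMod S.Q)) :
    ‖star (S.zKet j.1 j.2) ⬝ᵥ S.tKet τ G' v.1 v.2‖ ^ 2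
      = if j ∈ box H' (spike τ H') v.1 v.2 then (S.frameNormSq / ((S.Q : ℕ) : ℝ) ^ S.n / H') ^ 2
        else 0 := by
  rw [S.normSq_zKet_tKet h hQ τ]
  by_cases hc : j ∈ box H' (spike τ H') v.1 v.2
  · rw [if_pos hc, if_pos (mem_box.1 hc)]
  · rw [if_neg hc, if_neg (fun h' => hc (mem_box.2 h'))]

/-- **Bessel's equality for a straightened member over the test family at `τ`:**
`Σ_v ‖⟨u^τ_v | Z_{x,w}⟩‖² = (ν/Qⁿ)·⟨Z|Z⟩` — exactly `H′·H′ = #box` test vectors see `Z`, each with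
`(ν/Qⁿ/H′)²`; hence `Z` lies in the span of the test family. [folklore] -/
theorem sum_normSq_tKet_zKet (h : S.Admissible) {G' H' : ℕ} (hQ : (S.Q : ℕ) = G' * H') (τ : Fin S.n)
    (x : ZMod S.Q) (w : Fin S.n → ZMod S.Q) :
    ∑ v : ZMod S.Q × (Fin S.n → ZMod S.Q), ‖star (S.tKet τ G' v.1 v.2) ⬝ᵥ S.zKet x w‖ ^ 2
      = (S.frameNormSq / ((S.Q : ℕ) : ℝ) ^ S.n) * (star (S.zKet x w) ⬝ᵥ S.zKet x w).re := by
  have hH : 0 < H' := pos_right_of_eq_mul hQ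
  have hH'Q : H' ∣ (S.Q : ℕ) := ⟨G', by rw [hQ, mul_comm]⟩
  have hterm : ∀ v : ZMod S.Q × (Fin S.n → ZMod S.Q), ‖star (S.tKet τ G' v.1 v.2) ⬝ᵥ S.zKet x w‖ ^ 2
      = if v ∈ box H' (spike τ H') x w then (S.frameNormSq / ((S.Q : ℕ) : ℝ) ^ S.n / H') ^ 2 else 0 := by
    intro v
    rw [norm_star_dotProduct_comm, S.normSq_zKet_tKet_box h hQ τ (x, w) v]
    by_cases hv : v ∈ box H' (spike τ H') x w
    · rw [if_pos hv, if_pos ((mem_box_comm (v := v) (j := (x, w))).2 hv)]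
    · rw [if_neg hv, if_neg (fun h' => hv ((mem_box_comm (v := v) (j := (x, w))).1 h'))]
  have hsp : ∀ t, spike τ H' t ∣ (S.Q : ℕ) := fun t => by
    by_cases ht : t = τ
    · subst ht; rw [spike_self]; exact hH'Q
    · rw [spike_of_ne H' ht]; exact one_dvd _
  have hprod : ∏ t, spike τ H' t = H' := by
    rw [Finset.prod_eq_single τ (fun t _ ht => spike_of_ne H' ht) (fun hτ => absurd (Finset.mem_univ τ) hτ),
      spike_self]
  simp_rw [hterm]
  rw [Finset.sum_ite_mem, Finset.univ_inter, Finset.sum_const, nsmul_eq_mul, card_box hH'Q hsp x w, hprod,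
    S.star_zKet_dotProduct_zKet h, if_pos ⟨rfl, rfl⟩, Complex.ofReal_re]
  have hH0 : (H' : ℝ) ≠ 0 := by exact_mod_cast hH.ne'
  push_cast
  field_simp

/-- **The mass of a test vector on an orbit box:** if `v` is `H′`-close to the centre in `x` and at `τ`,
`H₀`-close on `T ∖ {τ}` and equal off `T`, then `Σ_{j ∈ box_{H₀,orbW}(c)} ‖⟨Z_j|u^τ_v⟩‖² = H₀²·(ν/Qⁿ/H′)²`
(the `H₀·H₀` members `j` with `H′(x_j − v_x) = 0`, `H′(w_j,τ − v_τ) = 0`, `w_j = v` elsewhere). [folklore] -/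
theorem sum_orbit_normSq (h : S.Admissible) {G' p H₀ H' : ℕ} (hH : H' = p * H₀)
    (hQ : (S.Q : ℕ) = G' * H') {T : Finset (Fin S.n)} {τ : Fin S.n} (hτ : τ ∈ T)
    (xc : ZMod S.Q) (wc : Fin S.n → ZMod S.Q) (v : ZMod S.Q × (Fin S.n → ZMod S.Q))
    (hxv : (H' : ZMod S.Q) * (xc - v.1) = 0) (hτv : (H' : ZMod S.Q) * (wc τ - v.2 τ) = 0)
    (hTv : ∀ t ∈ T, t ≠ τ → (H₀ : ZMod S.Q) * (v.2 t - wc t) = 0) (hoff : ∀ t, t ∉ T → v.2 t = wc t) :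
    ∑ j ∈ box H₀ (orbW T H₀) xc wc, ‖star (S.zKet j.1 j.2) ⬝ᵥ S.tKet τ G' v.1 v.2‖ ^ 2
      = ((H₀ : ℝ) * H₀) * (S.frameNormSq / ((S.Q : ℕ) : ℝ) ^ S.n / H') ^ 2 := by
  have hH' : (H' : ZMod S.Q) = (p : ZMod S.Q) * (H₀ : ZMod S.Q) := by rw [hH, Nat.cast_mul]
  have hH₀Q : H₀ ∣ (S.Q : ℕ) := ⟨G' * p, by rw [hQ, hH]; ring⟩
  have hg'' : ∀ t, (fun t => if t = τ then H₀ else 1) t ∣ (S.Q : ℕ) := fun t => by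
    by_cases ht : t = τ
    · simp only [if_pos ht]; exact hH₀Q
    · simp only [if_neg ht]; exact one_dvd _
  have hx' : ∀ e, (H₀ : ZMod S.Q) * (e - xc) = 0 → (H' : ZMod S.Q) * (e - v.1) = 0 := fun e he => by
    linear_combination (e - xc) * hH' + (p : ZMod S.Q) * he + hxv
  have ht' : ∀ (t : Fin S.n) (e : ZMod S.Q),
      (((orbW T H₀ t : ℕ) : ZMod S.Q) * (e - wc t) = 0 ∧ ((spike τ H' t : ℕ) : ZMod S.Q) * (e - v.2 t) = 0)
        ↔ (((fun t => if t = τ then H₀ else 1) t : ℕ) : ZMod S.Q)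
            * (e - (fun t => if t = τ then wc τ else v.2 t) t) = 0 := by
    intro t e
    by_cases ht : t = τ
    · rw [ht]
      simp only [orbW_of_mem H₀ hτ, spike_self, if_true]
      constructor
      · exact fun h' => h'.1
      · intro he
        exact ⟨he, by linear_combination (e - wc τ) * hH' + (p : ZMod S.Q) * he + hτv⟩
    · simp only [spike_of_ne H' ht, if_neg ht, Nat.cast_one, one_mul, sub_eq_zero]
      by_cases htT : t ∈ T
      · simp only [orbW_of_mem H₀ htT]
        constructor
        · exact fun h' => h'.2
        · intro he
          rw [he]
          exact ⟨hTv t htT ht, rfl⟩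
      · simp only [orbW_of_not_mem H₀ htT, Nat.cast_one, one_mul, sub_eq_zero]
        constructor
        · exact fun h' => h'.2
        · intro he
          exact ⟨he.trans (hoff t htT), he⟩
  simp_rw [S.normSq_zKet_tKet_box h hQ τ]
  rw [Finset.sum_ite_mem, Finset.sum_const, nsmul_eq_mul, box_inter_box_eq _ _ hx' ht', card_box hH₀Q hg'']
  congr 1
  rw [Finset.prod_eq_single τ (fun t _ ht => if_neg ht) (fun hτ' => absurd (Finset.mem_univ τ) hτ'),
    if_pos rfl]
  push_cast
  rfl

/-- A member `|u_{β;x,ȳ}⟩` with `β` supported on `T` lies in the class of any `U ⊇ T+1`, so an almost-sure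
measurement has an almost-certain outcome on it. [cite: ChenQuantumLattice2024, §3.1 p. 22, Lemma 3.13 pp. 32–34] -/
theorem exists_almostCertain_uKet (h : S.Admissible) {T : Finset (Fin S.n)} {U : Finset (Fin (S.n + 1))}
    (hTU : ∀ t ∈ T, t.succ ∈ U) {κ : Type*} [Fintype κ] {E : POVM (Fin (S.n + 1) → ZMod S.M) κ} {ε : ℝ}
    (hE : S.AlmostSureOn ε U E) (β : Fin S.n → ZMod S.Q) (x : ZMod S.Q) (yb : Fin S.n → ZMod S.Q)
    (hβ : ∀ t, t ∉ T → β t = 0) : ∃ k, E.AlmostCertain ε (S.uKet β x yb) k := by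
  have hfam : S.famBT T β = S.famBT Finset.univ β := by
    unfold famBT
    congr 1
    funext t
    unfold BfamT
    by_cases ht : t ∈ T
    · rw [if_pos ht, if_pos (Finset.mem_univ t)]
    · rw [if_neg ht, if_pos (Finset.mem_univ t), hβ t ht, ZMod.val_zero, Nat.cast_zero]
  have := hE (S.famBT T β) (S.vOf (S.xyv x yb)) (S.inClass_famT h T hTU β _)
  rwa [hfam] at this

end Shape

/-! ## Part V.  Outcome invariance: the elementary step, the chain, the induction over divisors -/

namespace Shape

variable (S : Shape)

/-- OUTCOME INVARIANCE AT MODULUS `H` (`H ∣ Q`): two straightened members whose `x`-coordinates and whose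
unknown tail coordinates (`t ∈ T`) are congruent modulo `Q/H` — i.e. `H·(difference) = 0` in `ℤ_Q` — and whose
known tail coordinates agree have THE SAME almost-certain outcome. `H = 1`: trivial; `H = Q`: the theorem.
[cite: ChenQuantumLattice2024, Lemma 3.13 pp. 32–34, §3.5.8 pp. 33–34] -/
def OutInv (T : Finset (Fin S.n)) {κ : Type*} [Fintype κ] (E : POVM (Fin (S.n + 1) → ZMod S.M) κ)
    (ε : ℝ) (H : ℕ) : Prop :=
  ∀ (x₁ x₂ : ZMod S.Q) (w₁ w₂ : Fin S.n → ZMod S.Q), (H : ZMod S.Q) * (x₁ - x₂) = 0 →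
    (∀ t ∈ T, (H : ZMod S.Q) * (w₁ t - w₂ t) = 0) → (∀ t, t ∉ T → w₁ t = w₂ t) →
      ∀ k₁ k₂ : κ, E.AlmostCertain ε (S.zKet x₁ w₁) k₁ → E.AlmostCertain ε (S.zKet x₂ w₂) k₂ → k₁ = k₂

/-- **The elementary step** (`H′ = p·H₀`, `Q = G′H′`, `32εp² ≤ 1`, outcome invariance at `H₀` known): two
straightened members that differ only in `(x, w_τ)` for ONE unknown coordinate `τ ∈ T`, by `H′`-torsion
amounts, have the same outcome. Proof = `POVM.frame_endgame` with the two `H₀`-orbit boxes as the frames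
(constant outcome on each by the induction hypothesis), the test vectors `u^τ_v` (class members: dummy slope
`G′e_τ` on the unknown coordinate `τ`) as the test family, the common test box `F` of size `p²·#orbit`, mass
`ρ = 1/p²` of each `u^τ_v` (`v ∈ F`) on either orbit (exact overlap formula), and Bessel's equality
(`Z ∈ span{u^τ_v}`). [cite: ChenQuantumLattice2024, Lemma 3.13 pp. 32–34, eq. (35) p. 31, §3.5.8 pp. 33–34;
NielsenChuang2010, §2.2.6 p. 90, Box 2.3 p. 87] -/
theorem outInv_elem_step (h : S.Admissible) {T : Finset (Fin S.n)} {κ : Type*} [Fintype κ] [DecidableEq κ]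
    (E : POVM (Fin (S.n + 1) → ZMod S.M) κ) {ε : ℝ}
    (hmem : ∀ (β : Fin S.n → ZMod S.Q) (x : ZMod S.Q) (yb : Fin S.n → ZMod S.Q),
      (∀ t, t ∉ T → β t = 0) → ∃ k, E.AlmostCertain ε (S.uKet β x yb) k)
    {G' p H₀ H' : ℕ} (hH : H' = p * H₀) (hQ : (S.Q : ℕ) = G' * H') (hp : 32 * ε * (p : ℝ) ^ 2 ≤ 1)
    (hInv : S.OutInv T E ε H₀) {τ : Fin S.n} (hτ : τ ∈ T) {x₁ x₂ : ZMod S.Q}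
    {w₁ w₂ : Fin S.n → ZMod S.Q} (hx : (H' : ZMod S.Q) * (x₁ - x₂) = 0)
    (hwτ : (H' : ZMod S.Q) * (w₁ τ - w₂ τ) = 0) (hw : ∀ t, t ≠ τ → w₁ t = w₂ t) {k₁ k₂ : κ}
    (hk₁ : E.AlmostCertain ε (S.zKet x₁ w₁) k₁) (hk₂ : E.AlmostCertain ε (S.zKet x₂ w₂) k₂) :
    k₁ = k₂ := by
  classical
  -- positivity bookkeeping
  have hH'pos : 0 < H' := pos_right_of_eq_mul hQ
  have hp0 : 0 < p := Nat.pos_of_ne_zero fun h0 => by rw [h0, zero_mul] at hH; omega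
  have hH₀pos : 0 < H₀ := Nat.pos_of_ne_zero fun h0 => by rw [h0, mul_zero] at hH; omega
  have hpr : (1 : ℝ) ≤ p := by exact_mod_cast hp0
  have hp2 : (0 : ℝ) < (p : ℝ) ^ 2 := by positivity
  have ha : 0 < S.frameNormSq / ((S.Q : ℕ) : ℝ) ^ S.n := S.frameNormSq_div_pos
  have hρ : (0 : ℝ) < 1 / (p : ℝ) ^ 2 := by positivity
  have hρ1 : 1 / (p : ℝ) ^ 2 ≤ 1 := by rw [div_le_one hp2]; nlinarith
  have hε : 32 * ε ≤ 1 / (p : ℝ) ^ 2 := by rw [le_div_iff₀ hp2]; exact hp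
  have hH'Q : H' ∣ (S.Q : ℕ) := ⟨G', by rw [hQ, mul_comm]⟩
  -- orthogonality of the frames and of the test family
  have horth : ∀ (J : Finset (ZMod S.Q × (Fin S.n → ZMod S.Q))) (j j' : ↥J),
      star (S.zKet j.1.1 j.1.2) ⬝ᵥ S.zKet j'.1.1 j'.1.2
        = if j = j' then (((S.frameNormSq / ((S.Q : ℕ) : ℝ) ^ S.n : ℝ)) : ℂ) else 0 := by
    intro J j j'
    rw [S.star_zKet_dotProduct_zKet h]
    by_cases hjj : j = j'
    · subst hjj; rw [if_pos ⟨rfl, rfl⟩, if_pos rfl]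
    · rw [if_neg hjj, if_neg]
      rintro ⟨h1, h2⟩
      exact hjj (Subtype.ext (Prod.ext h1 h2))
  have huf : ∀ v v' : ZMod S.Q × (Fin S.n → ZMod S.Q),
      star (S.tKet τ G' v.1 v.2) ⬝ᵥ S.tKet τ G' v'.1 v'.2
        = if v = v' then (((S.frameNormSq / ((S.Q : ℕ) : ℝ) ^ S.n : ℝ)) : ℂ) else 0 := by
    intro v v'
    rw [S.star_tKet_dotProduct_tKet h]
    by_cases hvv : v = v'
    · subst hvv; rw [if_pos ⟨rfl, rfl⟩, if_pos rfl]
    · rw [if_neg hvv, if_neg]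
      rintro ⟨h1, h2⟩
      exact hvv (Prod.ext h1 h2)
  -- every straightened member lies in the span of the test family (Bessel's equality)
  have hX : ∀ (x : ZMod S.Q) (w : Fin S.n → ZMod S.Q), S.zKet x w
      = frameProj (fun v : ZMod S.Q × (Fin S.n → ZMod S.Q) => S.tKet τ G' v.1 v.2)
          (S.frameNormSq / ((S.Q : ℕ) : ℝ) ^ S.n) (S.zKet x w) :=
    fun x w => eq_frameProj_of_bessel _ ha huf _ (S.sum_normSq_tKet_zKet h hQ τ x w)
  -- the test box and the masses
  have hFmem : ∀ v ∈ box H' (Function.update (orbW T H₀) τ H') x₁ w₁,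
      (H' : ZMod S.Q) * (v.1 - x₁) = 0 ∧ (H' : ZMod S.Q) * (v.2 τ - w₁ τ) = 0
        ∧ (∀ t ∈ T, t ≠ τ → (H₀ : ZMod S.Q) * (v.2 t - w₁ t) = 0) ∧ (∀ t, t ∉ T → v.2 t = w₁ t) := by
    intro v hv
    rw [mem_box] at hv
    obtain ⟨h1, h2⟩ := hv
    refine ⟨h1, ?_, fun t htT ht => ?_, fun t htT => ?_⟩
    · have h3 := h2 τ
      rwa [Function.update_self] at h3
    · have h3 := h2 t
      rwa [Function.update_of_ne ht, orbW_of_mem H₀ htT] at h3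
    · have ht : t ≠ τ := fun h' => htT (h' ▸ hτ)
      have h3 := h2 t
      rw [Function.update_of_ne ht, orbW_of_not_mem H₀ htT, Nat.cast_one, one_mul, sub_eq_zero] at h3
      exact h3
  have hM : ∀ (xc : ZMod S.Q) (wc : Fin S.n → ZMod S.Q), (H' : ZMod S.Q) * (xc - x₁) = 0 →
      (H' : ZMod S.Q) * (wc τ - w₁ τ) = 0 → (∀ t, t ≠ τ → wc t = w₁ t) →
        ∀ v ∈ box H' (Function.update (orbW T H₀) τ H') x₁ w₁,
          ∑ j : ↥(box H₀ (orbW T H₀) xc wc), ‖star (S.zKet j.1.1 j.1.2) ⬝ᵥ S.tKet τ G' v.1 v.2‖ ^ 2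
            = 1 / (p : ℝ) ^ 2 * (S.frameNormSq / ((S.Q : ℕ) : ℝ) ^ S.n) ^ 2 := by
    intro xc wc hxc hwc hwo v hv
    obtain ⟨h1, h2, h3, h4⟩ := hFmem v hv
    rw [Finset.sum_coe_sort (box H₀ (orbW T H₀) xc wc)
        (fun j => ‖star (S.zKet j.1 j.2) ⬝ᵥ S.tKet τ G' v.1 v.2‖ ^ 2),
      S.sum_orbit_normSq h hH hQ hτ xc wc v (by linear_combination hxc - h1)
        (by linear_combination hwc - h2) (fun t htT ht => by rw [hwo t ht]; exact h3 t htT ht)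
        (fun t htT => by rw [hwo t (fun h' => htT (h' ▸ hτ))]; exact h4 t htT), hH]
    push_cast
    have hp0' : (p : ℝ) ≠ 0 := by positivity
    have hH₀0 : (H₀ : ℝ) ≠ 0 := by exact_mod_cast hH₀pos.ne'
    field_simp
  -- outcomes: constant on each orbit (induction hypothesis); test vectors are in the class
  have hzmem : ∀ (x : ZMod S.Q) (w : Fin S.n → ZMod S.Q), ∃ k, E.AlmostCertain ε (S.zKet x w) k :=
    fun x w => hmem 0 x _ (fun _ _ => rfl)
  have horb : ∀ (xc : ZMod S.Q) (wc : Fin S.n → ZMod S.Q) (kc : κ), E.AlmostCertain ε (S.zKet xc wc) kc →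
      ∀ j : ↥(box H₀ (orbW T H₀) xc wc), E.AlmostCertain ε (S.zKet j.1.1 j.1.2) kc := by
    intro xc wc kc hkc j
    obtain ⟨k, hk⟩ := hzmem j.1.1 j.1.2
    have hj := j.2
    rw [mem_box] at hj
    obtain ⟨hj1, hj2⟩ := hj
    have hsame := hInv xc j.1.1 wc j.1.2 (by linear_combination (-1 : ZMod S.Q) * hj1)
      (fun t ht => by
        have h' := hj2 t
        rw [orbW_of_mem H₀ ht] at h'
        linear_combination (-1 : ZMod S.Q) * h')
      (fun t ht => by
        have h' := hj2 t
        rw [orbW_of_not_mem H₀ ht, Nat.cast_one, one_mul, sub_eq_zero] at h'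
        exact h'.symm)
      kc k hkc hk
    rw [hsame]; exact hk
  have hF' : ∀ v ∈ box H' (Function.update (orbW T H₀) τ H') x₁ w₁,
      ∃ k, E.AlmostCertain ε (S.tKet τ G' v.1 v.2) k := fun v _ =>
    hmem (Pi.single τ ((G' : ℕ) : ZMod S.Q)) v.1 _ fun t ht =>
      Pi.single_eq_of_ne (ne_of_mem_of_not_mem hτ ht).symm _
  -- the counts: `32ε·#orbit ≤ ρ²·#F` is `32εp² ≤ 1`
  have hcount : ∀ (xc : ZMod S.Q) (wc : Fin S.n → ZMod S.Q),
      32 * ε * (Fintype.card ↥(box H₀ (orbW T H₀) xc wc) : ℝ)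
        ≤ (1 / (p : ℝ) ^ 2) ^ 2 * ((box H' (Function.update (orbW T H₀) τ H') x₁ w₁).card : ℝ) := by
    intro xc wc
    rw [Fintype.card_coe, card_testBox hH hH'Q hτ x₁ xc w₁ wc]
    have key : ∀ J : ℝ, 0 ≤ J → 32 * ε * J ≤ (1 / (p : ℝ) ^ 2) ^ 2 * ((p : ℝ) ^ 2 * J) := fun J hJ => by
      have hp0' : (p : ℝ) ≠ 0 := by positivity
      have e : (1 / (p : ℝ) ^ 2) ^ 2 * ((p : ℝ) ^ 2 * J) = 1 / (p : ℝ) ^ 2 * J := by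
        field_simp
      rw [e]
      exact mul_le_mul_of_nonneg_right hε hJ
    exact key _ (Nat.cast_nonneg _)
  exact E.frame_endgame ha hρ hρ1 hε
    (fun j : ↥(box H₀ (orbW T H₀) x₁ w₁) => S.zKet j.1.1 j.1.2)
    (fun j : ↥(box H₀ (orbW T H₀) x₂ w₂) => S.zKet j.1.1 j.1.2)
    (fun v : ZMod S.Q × (Fin S.n → ZMod S.Q) => S.tKet τ G' v.1 v.2)
    (horth _) (horth _) huf (fun j => hX _ _) (fun j => hX _ _)
    (box H' (Function.update (orbW T H₀) τ H') x₁ w₁) ⟨(x₁, w₁), self_mem_box _ _ _ _⟩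
    (hM x₁ w₁ (by rw [sub_self, mul_zero]) (by rw [sub_self, mul_zero]) (fun _ _ => rfl))
    (hM x₂ w₂ (by linear_combination (-1 : ZMod S.Q) * hx) (by linear_combination (-1 : ZMod S.Q) * hwτ)
      (fun t ht => (hw t ht).symm))
    (horb x₁ w₁ k₁ hk₁) (horb x₂ w₂ k₂ hk₂) hF' (hcount x₁ w₁) (hcount x₂ w₂)

/-- **The induction step `H₀ → H′ = p·H₀`:** chain the elementary steps — first move `x` (together with
nothing else), then the unknown coordinates one at a time (`Finset.induction` over `T`), passing through
intermediate straightened members, all of which are class members with SOME almost-certain outcome.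
Needs `T ≠ ∅` (an unknown coordinate to host the dummy slope) and `ε < 1/2` (uniqueness of the outcome).
[cite: ChenQuantumLattice2024, Lemma 3.13 pp. 32–34, §3.5.8 pp. 33–34] -/
theorem outInv_step (h : S.Admissible) {T : Finset (Fin S.n)} (hTne : T.Nonempty) {κ : Type*} [Fintype κ]
    [DecidableEq κ] (E : POVM (Fin (S.n + 1) → ZMod S.M) κ) {ε : ℝ} (hε2 : ε < 1 / 2)
    (hmem : ∀ (β : Fin S.n → ZMod S.Q) (x : ZMod S.Q) (yb : Fin S.n → ZMod S.Q),
      (∀ t, t ∉ T → β t = 0) → ∃ k, E.AlmostCertain ε (S.uKet β x yb) k)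
    {G' p H₀ H' : ℕ} (hH : H' = p * H₀) (hQ : (S.Q : ℕ) = G' * H') (hp : 32 * ε * (p : ℝ) ^ 2 ≤ 1)
    (hInv : S.OutInv T E ε H₀) : S.OutInv T E ε H' := by
  classical
  intro x₁ x₂ w₁ w₂ hx hT hoff k₁ k₂ hk₁ hk₂
  obtain ⟨τ₀, hτ₀⟩ := hTne
  have hzmem : ∀ (x : ZMod S.Q) (w : Fin S.n → ZMod S.Q), ∃ k, E.AlmostCertain ε (S.zKet x w) k :=
    fun x w => hmem 0 x _ (fun _ _ => rfl)
  have hne : ∀ (x : ZMod S.Q) (w : Fin S.n → ZMod S.Q), S.zKet x w ≠ 0 := fun x w h0 => by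
    have h1 := S.star_zKet_dotProduct_zKet h x x w w
    rw [if_pos ⟨rfl, rfl⟩, h0, star_zero, zero_dotProduct] at h1
    have h2 := congrArg Complex.re h1
    rw [Complex.zero_re, Complex.ofReal_re] at h2
    exact absurd h2 (ne_of_lt S.frameNormSq_div_pos)
  -- Step 1: move `x`
  obtain ⟨k', hk'⟩ := hzmem x₂ w₁
  have e1 : k₁ = k' :=
    S.outInv_elem_step h E hmem hH hQ hp hInv hτ₀ hx (by rw [sub_self, mul_zero]) (fun _ _ => rfl) hk₁ hk'
  -- Step 2: move the unknown coordinates one at a time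
  have e2 : ∀ A : Finset (Fin S.n), A ⊆ T →
      ∀ k, E.AlmostCertain ε (S.zKet x₂ (fun t => if t ∈ A then w₂ t else w₁ t)) k → k' = k := by
    intro A
    induction A using Finset.induction_on with
    | empty =>
      intro _ k hk
      simp only [Finset.notMem_empty, if_false] at hk
      exact E.almostCertain_unique hε2 (hne x₂ w₁) hk' hk
    | insert t A htA ih =>
      intro hsub k hk
      have htT : t ∈ T := hsub (Finset.mem_insert_self t A)
      have hA : A ⊆ T := fun s hs => hsub (Finset.mem_insert_of_mem hs)
      obtain ⟨k'', hk''⟩ := hzmem x₂ (fun s => if s ∈ A then w₂ s else w₁ s)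
      rw [ih hA k'' hk'']
      have hAt : (if t ∈ A then w₂ t else w₁ t) = w₁ t := by simp [htA]
      have hIt : (if t ∈ insert t A then w₂ t else w₁ t) = w₂ t := by simp
      refine S.outInv_elem_step h E hmem hH hQ hp hInv htT (x₁ := x₂) (x₂ := x₂)
        (by rw [sub_self, mul_zero]) (by rw [hAt, hIt]; exact hT t htT) (fun s hs => ?_) hk'' hk
      have : (s ∈ insert t A) ↔ s ∈ A := by rw [Finset.mem_insert]; exact or_iff_right hs
      simp only [this]
  have hmix : (fun t => if t ∈ T then w₂ t else w₁ t) = w₂ := by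
    funext t
    by_cases ht : t ∈ T
    · rw [if_pos ht]
    · rw [if_neg ht, hoff t ht]
  have e3 := e2 T (subset_refl T) k₂ (by rw [hmix]; exact hk₂)
  rw [e1, e3]

/-- **Outcome invariance at every divisor of `Q`**, by strong induction over `H ∣ Q` (split off the least
prime factor `p = minFac H`; the step costs `32εp² ≤ 1`; `ε < 1/2` follows from the hypothesis at
`p = minFac Q ≥ 2`). [cite: ChenQuantumLattice2024, Lemma 3.13 pp. 32–34, §3.5.8 pp. 33–34] -/
theorem outInv_of_dvd (h : S.Admissible) {T : Finset (Fin S.n)} (hTne : T.Nonempty) {κ : Type*}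
    [Fintype κ] [DecidableEq κ] (E : POVM (Fin (S.n + 1) → ZMod S.M) κ) {ε : ℝ}
    (hmem : ∀ (β : Fin S.n → ZMod S.Q) (x : ZMod S.Q) (yb : Fin S.n → ZMod S.Q),
      (∀ t, t ∉ T → β t = 0) → ∃ k, E.AlmostCertain ε (S.uKet β x yb) k)
    (hε : ∀ p ∈ (S.Q : ℕ).primeFactors, 32 * ε * (p : ℝ) ^ 2 ≤ 1) (H : ℕ) (hH : H ∣ (S.Q : ℕ)) :
    S.OutInv T E ε H := by
  classical
  have hQ1 : 1 < (S.Q : ℕ) := lt_of_lt_of_le (by norm_num) h.three_le_Q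
  have hε2 : ε < 1 / 2 := by
    have hm : (S.Q : ℕ).minFac ∈ (S.Q : ℕ).primeFactors :=
      Nat.mem_primeFactors.2 ⟨Nat.minFac_prime hQ1.ne', Nat.minFac_dvd _, S.Q.ne_zero⟩
    have h1 := hε _ hm
    have h2 : (2 : ℝ) ≤ (S.Q : ℕ).minFac := by exact_mod_cast (Nat.minFac_prime hQ1.ne').two_le
    nlinarith
  have hne : ∀ (x : ZMod S.Q) (w : Fin S.n → ZMod S.Q), S.zKet x w ≠ 0 := fun x w h0 => by
    have h1 := S.star_zKet_dotProduct_zKet h x x w w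
    rw [if_pos ⟨rfl, rfl⟩, h0, star_zero, zero_dotProduct] at h1
    have h2 := congrArg Complex.re h1
    rw [Complex.zero_re, Complex.ofReal_re] at h2
    exact absurd h2 (ne_of_lt S.frameNormSq_div_pos)
  induction H using Nat.strong_induction_on with
  | _ H ih =>
    rcases Nat.lt_or_ge 1 H with hH1 | hH1
    · -- `H > 1`: split off `p = minFac H`
      have hp : H.minFac.Prime := Nat.minFac_prime hH1.ne'
      obtain ⟨H₀, hH₀⟩ := Nat.minFac_dvd H
      have hH₀pos : 0 < H₀ := Nat.pos_of_ne_zero fun h0 => by rw [h0, mul_zero] at hH₀; omega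
      have hH₀lt : H₀ < H := by
        have h2 := hp.two_le
        calc H₀ < 2 * H₀ := by omega
          _ ≤ H.minFac * H₀ := Nat.mul_le_mul_right _ h2
          _ = H := hH₀.symm
      have hH₀dvd : H₀ ∣ (S.Q : ℕ) := dvd_trans (Dvd.intro_left _ hH₀.symm) hH
      obtain ⟨G', hG'⟩ := hH
      have hQ : (S.Q : ℕ) = G' * H := by rw [hG', mul_comm]
      have hpQ : H.minFac ∈ (S.Q : ℕ).primeFactors :=
        Nat.mem_primeFactors.2 ⟨hp, dvd_trans (Nat.minFac_dvd H) ⟨G', hG'⟩, S.Q.ne_zero⟩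
      exact S.outInv_step h hTne E hε2 hmem hH₀ hQ (hε _ hpQ) (ih H₀ hH₀lt hH₀dvd)
    · -- `H ≤ 1`: `H = 1` (as `H ∣ Q ≠ 0`), nothing moves
      have hH0 : H ≠ 0 := by
        rintro rfl
        exact S.Q.ne_zero (zero_dvd_iff.1 hH)
      have hHone : H = 1 := by omega
      subst hHone
      intro x₁ x₂ w₁ w₂ hx hT hoff k₁ k₂ hk₁ hk₂
      simp only [Nat.cast_one, one_mul, sub_eq_zero] at hx hT
      have hw : w₁ = w₂ := funext fun t => if ht : t ∈ T then hT t ht else hoff t ht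
      subst hx
      subst hw
      exact E.almostCertain_unique hε2 (hne x₁ w₁) hk₁ hk₂

/-- **Same outcome for any two straightened members with equal known coordinates** (`H = Q`).
[cite: ChenQuantumLattice2024, Lemma 3.13 pp. 32–34, §3.5.8 pp. 33–34] -/
theorem sameOut_zKet (h : S.Admissible) {T : Finset (Fin S.n)} (hTne : T.Nonempty) {κ : Type*}
    [Fintype κ] [DecidableEq κ] (E : POVM (Fin (S.n + 1) → ZMod S.M) κ) {ε : ℝ}
    (hmem : ∀ (β : Fin S.n → ZMod S.Q) (x : ZMod S.Q) (yb : Fin S.n → ZMod S.Q),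
      (∀ t, t ∉ T → β t = 0) → ∃ k, E.AlmostCertain ε (S.uKet β x yb) k)
    (hε : ∀ p ∈ (S.Q : ℕ).primeFactors, 32 * ε * (p : ℝ) ^ 2 ≤ 1) (x₁ x₂ : ZMod S.Q)
    {w₁ w₂ : Fin S.n → ZMod S.Q} (hoff : ∀ t, t ∉ T → w₁ t = w₂ t) {k₁ k₂ : κ}
    (hk₁ : E.AlmostCertain ε (S.zKet x₁ w₁) k₁) (hk₂ : E.AlmostCertain ε (S.zKet x₂ w₂) k₂) : k₁ = k₂ :=
  S.outInv_of_dvd h hTne E hmem hε (S.Q : ℕ) dvd_rfl x₁ x₂ w₁ w₂ (by rw [ZMod.natCast_self, zero_mul])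
    (fun _ _ => by rw [ZMod.natCast_self, zero_mul]) hoff k₁ k₂ hk₁ hk₂

/-! ## Part VI.  The theorem: the Step-8 tolerance ceiling holds at `32·ε·𝔭(Q)² ≤ 1` for EVERY `Q` -/

/-- **The approximate Step-8 measurement ceiling for every admissible modulus** (`𝔭(Q)` := the largest prime
factor of `Q = D²P`): if a general measurement (POVM) of the Step-8 register is `ε`-almost sure on the
Karst-wave class `InClass U` of `S` with at least one unknown tail coordinate (`t₁+1 ∈ U`), and
`32·ε·p² ≤ 1` for every prime `p ∣ Q` (i.e. `32·ε·𝔭(Q)² ≤ 1`), then `|φ7.d⟩` of `S` and of the shifted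
instance `(b, v′ + 2D²p₁b)` — whose Step-9 requirements differ — get THE SAME almost-certain outcome: the
measurement cannot supply what Step 9 needs. Together with
`Shape.step8_povm_ceiling_fails_at_inv_prime_sq` (failure at `ε = 1/p²` for every prime `p ∣ Q`, in
particular at `1/𝔭(Q)²`) this pins the tolerance threshold of Chen's Step 8 at `Θ(1/𝔭(Q)²)` for ALL
admissible `Q`, with the constant in `[1/32, 1]` — for squarefree `Q` (Chen's own `Q = p₂⋯p_κ` with
distinct planted primes) this is module (Y)'s `Shape.step8_povm_ceiling_order_squarefree` (window
`[1/4, 1]`); the new content is prime powers in `Q`, which the formal predicate `Shape.Admissible` allows,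
and a union-bound-free proof for all `Q`. Proof: outcome invariance at modulus `H ∣ Q`
by induction over the divisor lattice (`Shape.outInv_of_dvd`), each prime step an exact frame/trace
computation (`POVM.frame_endgame`) — no union bound over the `p^{2k}` orbit members, which is what the
pairwise argument of (W) `Shape.step8_povm_ceiling_sharp` (`4εQ² < 1`) pays for.
HONEST FRAMING: a theorem about the measurement step of a WITHDRAWN algorithm (Chen, ePrint 2024/555,
Step 9 retracted 2024-04-18); it says how INSENSITIVE Step 8's failure is to approximate measurement, it
does not repair Step 9, breaks nothing, and is not progress on any lattice problem.
[cite: ChenQuantumLattice2024, Lemma 3.13 pp. 32–34, eq. (35) p. 31, §3.5.8 pp. 33–34, p. 37;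
NielsenChuang2010, §2.2.6 p. 90, Box 2.3 p. 87] -/
theorem step8_povm_ceiling_largestPrime (h : S.Admissible) {κ : Type*} [Fintype κ] [DecidableEq κ]
    (U : Finset (Fin (S.n + 1))) (t₁ : Fin S.n) (ht₁ : t₁.succ ∈ U)
    (E : POVM (Fin (S.n + 1) → ZMod S.M) κ) {ε : ℝ}
    (hε : ∀ p ∈ (S.Q : ℕ).primeFactors, 32 * ε * (p : ℝ) ^ 2 ≤ 1) (hE : S.AlmostSureOn ε U E)
    {k k' : κ} (hk : E.AlmostCertain ε S.phi7d k)
    (hk' : E.AlmostCertain ε (S.inst S.b (fun i => S.v' i + 2 * (S.D : ℤ) * S.D * S.p₁ * S.b i)).phi7d k') :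
    k = k' := by
  classical
  obtain ⟨c₀, x₀, y₀, hφS, hφS'⟩ : ∃ (c₀ : S.Coset) (x₀ : ZMod S.Q) (y₀ : Fin S.n → ZMod S.Q),
      S.phi7d = (S.cshape c₀).uKet 0 x₀ y₀
      ∧ (S.inst S.b (fun i => S.v' i + 2 * (S.D : ℤ) * S.D * S.p₁ * S.b i)).phi7d
          = (S.cshape c₀).uKet 0 (x₀ - 1) (fun t => y₀ t + ((S.b t.succ : ℤ) : ZMod S.Q)) :=
    ⟨_, _, _, S.phi7d_eq_uKet h, S.phi7d_shift_eq_uKet h⟩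
  have h₀ : (S.cshape c₀).Admissible := S.cshape_admissible h c₀
  -- the unknown tail coordinates
  set T : Finset (Fin S.n) := Finset.univ.filter fun t => t.succ ∈ U with hT
  have hTU : ∀ t ∈ T, t.succ ∈ U := fun t ht => (Finset.mem_filter.1 ht).2
  have hTne : T.Nonempty := ⟨t₁, Finset.mem_filter.2 ⟨Finset.mem_univ _, ht₁⟩⟩
  -- the class of the base-class shape is the class of `S`
  have hE₀ : (S.cshape c₀).AlmostSureOn ε U E := fun b₂ v₂ hI => hE b₂ v₂ hI
  have hmem : ∀ (β : Fin S.n → ZMod S.Q) (x : ZMod S.Q) (yb : Fin S.n → ZMod S.Q),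
      (∀ t, t ∉ T → β t = 0) → ∃ k, E.AlmostCertain ε ((S.cshape c₀).uKet β x yb) k :=
    fun β x yb hβ => (S.cshape c₀).exists_almostCertain_uKet h₀ hTU hE₀ β x yb hβ
  -- the two states as straightened members `Z_{x₀, w₀}` and `Z_{x₀ − 1, w₀}`
  set w₀ : Fin S.n → ZMod S.Q := y₀ + x₀ • (S.cshape c₀).bbar with hw₀
  have hz₁ : (S.cshape c₀).zKet x₀ w₀ = S.phi7d := by
    rw [hφS, Shape.zKet, hw₀, add_sub_cancel_right]
  have hz₂ : (S.cshape c₀).zKet (x₀ - 1) w₀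
      = (S.inst S.b (fun i => S.v' i + 2 * (S.D : ℤ) * S.D * S.p₁ * S.b i)).phi7d := by
    rw [hφS', Shape.zKet, hw₀]
    congr 1
    funext t
    rw [Pi.sub_apply, Pi.add_apply, Pi.smul_apply, Pi.smul_apply, smul_eq_mul, smul_eq_mul,
      show (S.cshape c₀).bbar t = ((S.b t.succ : ℤ) : ZMod S.Q) from rfl]
    ring
  exact (S.cshape c₀).sameOut_zKet h₀ hTne E hmem hε x₀ (x₀ - 1) (w₁ := w₀) (w₂ := w₀) (fun _ _ => rfl)
    (by rw [hz₁]; exact hk) (by rw [hz₂]; exact hk')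

/-- **The order of the threshold for every admissible `Q`:** ceiling at `32ε𝔭(Q)² ≤ 1`, failure at
`ε = 1/p²` for every prime `p ∣ Q` — the tolerance threshold of the Step-8 measurement is `Θ(1/𝔭(Q)²)`,
`𝔭(Q)` the largest prime factor of `Q`, constants in `[1/32, 1]`, for ALL admissible shapes (no
squarefree hypothesis). HONEST FRAMING as above: a theorem about a WITHDRAWN algorithm, not a repair.
[cite: ChenQuantumLattice2024, Lemma 3.13 pp. 32–34, §3.5.8 pp. 33–34, p. 37; NielsenChuang2010, §2.2.6 p. 90] -/
theorem step8_povm_ceiling_order (h : S.Admissible) (U : Finset (Fin (S.n + 1))) :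
    (∀ {κ : Type} [Fintype κ] [DecidableEq κ] (t₁ : Fin S.n), t₁.succ ∈ U →
        ∀ (E : POVM (Fin (S.n + 1) → ZMod S.M) κ) {ε : ℝ},
          (∀ p ∈ (S.Q : ℕ).primeFactors, 32 * ε * (p : ℝ) ^ 2 ≤ 1) →
          S.AlmostSureOn ε U E →
            ∀ k k' : κ, E.AlmostCertain ε S.phi7d k →
              E.AlmostCertain ε (S.inst S.b (fun i => S.v' i + 2 * (S.D : ℤ) * S.D * S.p₁ * S.b i)).phi7d k'
                → k = k')
    ∧ ∀ p ∈ (S.Q : ℕ).primeFactors, ∃ (E : POVM (Fin (S.n + 1) → ZMod S.M) (Fin 2)) (k k' : Fin 2),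
        S.AlmostSureOn (1 / (p : ℝ) ^ 2) U E ∧ k ≠ k'
        ∧ E.AlmostCertain (1 / (p : ℝ) ^ 2) S.phi7d k
        ∧ E.AlmostCertain (1 / (p : ℝ) ^ 2)
            (S.inst S.b (fun i => S.v' i + 2 * (S.D : ℤ) * S.D * S.p₁ * S.b i)).phi7d k' :=
  ⟨fun t₁ ht₁ E _ hε hE _ _ hk hk' => S.step8_povm_ceiling_largestPrime h U t₁ ht₁ E hε hE hk hk',
    fun _ hp => S.step8_povm_ceiling_fails_at_inv_prime_sq h U (Nat.prime_of_mem_primeFactors hp)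
      (Nat.dvd_of_mem_primeFactors hp)⟩


/-! ## Part VII.  Corollary: every offset shift `v ↦ v + 2D²p₁·(a·b₂ + m)` at once -/

/-- **Same-slope pairs in general.**  Under the hypotheses of `Shape.step8_povm_ceiling_largestPrime`
(`32·ε·p² ≤ 1` for every prime `p ∣ Q`, `E` `ε`-almost sure on `InClass U`, one unknown tail coordinate
`t₁+1 ∈ U`), the `ε`-almost-certain outcomes agree on ANY two instances `(b₂, v₂) ∈ InClass U` and
`(b₂, v₃)` with `v₃ ≡ v₂ + 2D²p₁·(a·b₂ + m) (mod M)`, `a ∈ ℤ`, `m` supported on the unknown coordinates and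
`m₀ = 0` — i.e. the conclusion of (W) `Shape.step8_povm_ceiling_dvd` for EVERY divisor level `g` at once
(there: shift `2D²p₁·g·(a·b₂ + m)` under `4·ε·q² < 1`, `g·q = Q`) and of (W) `Shape.step8_povm_ceiling_sharp`
(`4·ε·Q² < 1`) restricted to equal slopes `b₃ = b₂`.  In the straightened coordinates of Part IV the two states
are the members `Z_{x, w}` and `Z_{x − a, w + m̄}` of the base class of `(b₂, v₂)` (`m̄_t = m_{t+1} mod Q`,
supported on `T = {t : t+1 ∈ U}`), so this is `Shape.sameOut_zKet` at modulus `H = Q` (admissibility of `S` itself is not needed: that of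
`(b₂, v₂)` is part of `InClass`).  Pairs with different slopes `b₃ ≠ b₂` on `U` are Part XII's
`Shape.step8_povm_ceiling_largestPrime_pairs` (v3; the slope side needs Parts IX–XI).  HONEST FRAMING: a
theorem about the measurement step of a WITHDRAWN algorithm; it repairs nothing and breaks nothing.
[cite: ChenQuantumLattice2024, Lemma 3.13 pp. 32–34, eq. (35) p. 31, §3.5.8 pp. 33–34; NielsenChuang2010, §2.2.6 p. 90] -/
theorem step8_povm_ceiling_largestPrime_offsets {κ : Type*} [Fintype κ] [DecidableEq κ]
    (U : Finset (Fin (S.n + 1))) (t₁ : Fin S.n) (ht₁ : t₁.succ ∈ U)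
    (E : POVM (Fin (S.n + 1) → ZMod S.M) κ) {ε : ℝ}
    (hε : ∀ p ∈ (S.Q : ℕ).primeFactors, 32 * ε * (p : ℝ) ^ 2 ≤ 1) (hE : S.AlmostSureOn ε U E)
    {b₂ v₂ v₃ : Fin (S.n + 1) → ℤ} (hI₂ : S.InClass U b₂ v₂)
    (a : ℤ) (m : Fin (S.n + 1) → ℤ) (hm0 : m 0 = 0) (hmU : ∀ i, i ∉ U → m i = 0)
    (hv : ∀ i, ((v₃ i : ℤ) : ZMod S.M)
      = ((v₂ i + 2 * (S.D : ℤ) * S.D * S.p₁ * (a * b₂ i + m i) : ℤ) : ZMod S.M))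
    {k₂ k₃ : κ} (hk₂ : E.AlmostCertain ε (S.inst b₂ v₂).phi7d k₂)
    (hk₃ : E.AlmostCertain ε (S.inst b₂ v₃).phi7d k₃) :
    k₂ = k₃ := by
  classical
  -- pass to the instance `S₂ := (b₂, v₂)`; its class `InClass U` is the class of `S`
  set S₂ : Shape := S.inst b₂ v₂ with hS₂
  have h₂ : S₂.Admissible := hI₂.2
  have hb₂0 : b₂ 0 = -1 := h₂.b_head
  have hE₂ : S₂.AlmostSureOn ε U E := by
    intro b v hI
    refine hE b v ⟨fun i hi => ?_, hI.2⟩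
    rw [hI.1 i hi]
    exact hI₂.1 i hi
  -- `v₃ ≡ v₂ + L·e (mod M)` with `e := a·b₂ + m`, so `|φ7.d(b₂, v₃)⟩ = |φ7.d(b₂, v₂ + L·e)⟩`
  set e : Fin (S.n + 1) → ℤ := fun i => a * b₂ i + m i with he
  have hφ₃ : (S.inst b₂ v₃).phi7d = (S₂.inst S₂.b (fun i => S₂.v' i + S₂.L * e i)).phi7d := by
    have h' : (S.inst b₂ v₃).phi7d = (S.inst b₂ (fun i => v₂ i + S.L * e i)).phi7d :=
      S.phi7d_inst_congr b₂ _ v₃ fun i => by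
        rw [hv i]
        simp only [Shape.L, he]
    exact h'
  -- both states as members of the base class of `S₂`
  set c : S₂.Coset := S₂.cosetOf S₂.v' with hc
  set x₀ : ZMod S.Q := ((S₂.quotOf S₂.v' 0 : ℤ) : ZMod S.Q) with hx₀
  set y₀ : Fin S.n → ZMod S.Q := fun t => ((S₂.quotOf S₂.v' t.succ : ℤ) : ZMod S.Q) with hy₀
  have hφS : S₂.phi7d = (S₂.cshape c).uKet 0 x₀ y₀ := S₂.phi7d_eq_uKet h₂
  have hφS' : (S.inst b₂ v₃).phi7d
      = (S₂.cshape c).uKet 0 (x₀ - (a : ZMod S.Q))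
          (fun t => y₀ t + (a : ZMod S.Q) * ((b₂ t.succ : ℤ) : ZMod S.Q)
            + ((m t.succ : ℤ) : ZMod S.Q)) := by
    rw [hφ₃, S₂.phi7d_inst_shift_eq_uKet h₂ e]
    have hb : S₂.b = b₂ := rfl
    congr 1
    · rw [hx₀]
      simp only [he, hm0]
      rw [hb₂0]
      push_cast
      ring
    · funext t
      simp only [he, hy₀]
      push_cast
      ring
  have h₀ : (S₂.cshape c).Admissible := S₂.cshape_admissible h₂ c
  -- the unknown tail coordinates
  set T : Finset (Fin S.n) := Finset.univ.filter fun t => t.succ ∈ U with hT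
  have hTU : ∀ t ∈ T, t.succ ∈ U := fun t ht => (Finset.mem_filter.1 ht).2
  have hTne : T.Nonempty := ⟨t₁, Finset.mem_filter.2 ⟨Finset.mem_univ _, ht₁⟩⟩
  have hE₀ : (S₂.cshape c).AlmostSureOn ε U E := fun b v hI => hE₂ b v hI
  have hmem : ∀ (β : Fin S.n → ZMod S.Q) (x : ZMod S.Q) (yb : Fin S.n → ZMod S.Q),
      (∀ t, t ∉ T → β t = 0) → ∃ k, E.AlmostCertain ε ((S₂.cshape c).uKet β x yb) k :=
    fun β x yb hβ => (S₂.cshape c).exists_almostCertain_uKet h₀ hTU hE₀ β x yb hβ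
  -- straightened coordinates: `Z_{x₀, w₀}` and `Z_{x₀ − a, w₀ + m̄}`
  set w₀ : Fin S.n → ZMod S.Q := y₀ + x₀ • (S₂.cshape c).bbar with hw₀
  set mb : Fin S.n → ZMod S.Q := fun t => ((m t.succ : ℤ) : ZMod S.Q) with hmb
  have hbbar : ∀ t, (S₂.cshape c).bbar t = ((b₂ t.succ : ℤ) : ZMod S.Q) := fun _ => rfl
  have hz₁ : (S₂.cshape c).zKet x₀ w₀ = (S.inst b₂ v₂).phi7d := by
    rw [show (S.inst b₂ v₂).phi7d = S₂.phi7d from rfl, hφS, Shape.zKet, hw₀, add_sub_cancel_right]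
  have hz₂ : (S₂.cshape c).zKet (x₀ - (a : ZMod S.Q)) (w₀ + mb) = (S.inst b₂ v₃).phi7d := by
    rw [hφS', Shape.zKet, hw₀]
    congr 1
    funext t
    rw [Pi.sub_apply, Pi.add_apply, Pi.add_apply, Pi.smul_apply, Pi.smul_apply, smul_eq_mul,
      smul_eq_mul, hbbar t, hmb]
    ring
  have hoff : ∀ t, t ∉ T → w₀ t = (w₀ + mb) t := by
    intro t ht
    have hsU : t.succ ∉ U := fun hs => ht (Finset.mem_filter.2 ⟨Finset.mem_univ _, hs⟩)
    rw [Pi.add_apply, hmb]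
    simp only [hmU t.succ hsU, Int.cast_zero, add_zero]
  exact (S₂.cshape c).sameOut_zKet h₀ hTne E hmem hε x₀ (x₀ - (a : ZMod S.Q)) hoff
    (by rw [hz₁]; exact hk₂) (by rw [hz₂]; exact hk₃)

/-! ## Part VIII.  Packaged as in (P)/(W): Step 8 cannot supply Step 9's datum at tolerance `32·ε·𝔭(Q)² ≤ 1` -/

/-- **Corollary (tolerance `32·ε·𝔭(Q)² ≤ 1`): no measurement of the Step-8 register supplies what Step 9
consumes, even approximately** — the statement of (W) `Shape.step8_cannot_supply_step9Needs_povm_sharp`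
(there: `4·ε·Q² < 1`) at the sharp order for every admissible `Q`: for any unknown coordinates `U ∋ t₁+1`
and any POVM `ε`-almost sure on the class with `32·ε·p² ≤ 1` for every prime `p ∣ Q`, the admissible
instance `(b, v′ + 2D²p₁b)` — same `b`, same `step8Output`, DIFFERENT `step9Needs` — receives the same
almost-certain outcome as `S`.  HONEST FRAMING: about a WITHDRAWN algorithm; repairs nothing, breaks nothing.
[cite: ChenQuantumLattice2024, Lemma 3.13 p. 32, §3.5.9 p. 37] -/
theorem step8_cannot_supply_step9Needs_povm_largestPrime (h : S.Admissible) {κ : Type*} [Fintype κ]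
    [DecidableEq κ] (U : Finset (Fin (S.n + 1))) (t₁ : Fin S.n) (ht₁ : t₁.succ ∈ U)
    (E : POVM (Fin (S.n + 1) → ZMod S.M) κ) {ε : ℝ}
    (hε : ∀ p ∈ (S.Q : ℕ).primeFactors, 32 * ε * (p : ℝ) ^ 2 ≤ 1) (hE : S.AlmostSureOn ε U E) :
    ∃ v₃ : Fin (S.n + 1) → ℤ, (S.inst S.b v₃).Admissible
      ∧ (S.inst S.b v₃).step8Output = S.step8Output
      ∧ (S.inst S.b v₃).step9Needs ≠ S.step9Needs
      ∧ ∀ k k' : κ, E.AlmostCertain ε S.phi7d k → E.AlmostCertain ε (S.inst S.b v₃).phi7d k' → k = k' := by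
  have h₃' : (S.inst S.b (fun i => S.v' i + 2 * (S.D : ℤ) * S.D * S.p₁ * S.b i)).Admissible :=
    S.inst_admissible h h.b_head h.b_tail fun i =>
      dvd_add (h.v'_in_DZ i) ⟨2 * S.D * S.p₁ * S.b i, by ring⟩
  refine ⟨fun i => S.v' i + 2 * (S.D : ℤ) * S.D * S.p₁ * S.b i, h₃', ?_, ?_, ?_⟩
  · show (((S.v' 0 + 2 * (S.D : ℤ) * S.D * S.p₁ * S.b 0 : ℤ)) : ZMod ((S.D : ℕ) ^ 2 * S.p₁))
        = ((S.v' 0 : ℤ) : ZMod ((S.D : ℕ) ^ 2 * S.p₁))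
    rw [ZMod.intCast_eq_intCast_iff_dvd_sub, h.b_head]
    exact ⟨2, by push_cast; ring⟩
  · show (((S.v' 0 + 2 * (S.D : ℤ) * S.D * S.p₁ * S.b 0 : ℤ)) : ZMod S.N) ≠ ((S.v' 0 : ℤ) : ZMod S.N)
    rw [Ne, ZMod.intCast_eq_intCast_iff_dvd_sub, h.b_head, S.N_coe, S.P_coe]
    rintro ⟨c, hc⟩
    have hD : (0 : ℤ) < S.D := by exact_mod_cast S.D.pos
    have hp : (0 : ℤ) < S.p₁ := by exact_mod_cast S.p₁.pos
    have hQ3 : (3 : ℤ) ≤ S.Q := by exact_mod_cast h.three_le_Q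
    have hc' : (S.D : ℤ) * S.D * S.p₁ * (2 - S.Q * c) = 0 := by linear_combination hc
    have h2 : (2 : ℤ) - S.Q * c = 0 := by
      rcases mul_eq_zero.1 hc' with h1 | h1
      · exfalso
        have : (0 : ℤ) < (S.D : ℤ) * S.D * S.p₁ := by positivity
        exact this.ne' h1
      · exact h1
    have : (S.Q : ℤ) * c = 2 := by linarith
    rcases lt_trichotomy c 0 with hc0 | hc0 | hc0
    · nlinarith
    · rw [hc0, mul_zero] at this
      norm_num at this
    · nlinarith
  · intro k k' hk hk'
    exact S.step8_povm_ceiling_largestPrime h U t₁ ht₁ E hε hE hk hk'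

/-- The same for the full class (every coordinate `≥ 1` unknown, `n ≥ 1`), tolerance `32·ε·𝔭(Q)² ≤ 1`.
[cite: ChenQuantumLattice2024, Lemma 3.13 p. 32, §3.5.9 p. 37] -/
theorem step8_cannot_supply_step9Needs_povm_largestPrime' (h : S.Admissible) (hn : 0 < S.n) {κ : Type*}
    [Fintype κ] [DecidableEq κ] (E : POVM (Fin (S.n + 1) → ZMod S.M) κ) {ε : ℝ}
    (hε : ∀ p ∈ (S.Q : ℕ).primeFactors, 32 * ε * (p : ℝ) ^ 2 ≤ 1)
    (hE : S.AlmostSureOn ε Finset.univ E) :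
    ∃ v₃ : Fin (S.n + 1) → ℤ, (S.inst S.b v₃).Admissible
      ∧ (S.inst S.b v₃).step8Output = S.step8Output
      ∧ (S.inst S.b v₃).step9Needs ≠ S.step9Needs
      ∧ ∀ k k' : κ, E.AlmostCertain ε S.phi7d k → E.AlmostCertain ε (S.inst S.b v₃).phi7d k' → k = k' :=
  S.step8_cannot_supply_step9Needs_povm_largestPrime h Finset.univ ⟨0, hn⟩ (Finset.mem_univ _) E hε hE

/-- **Corollary (tolerance `32·ε·𝔭(Q)² ≤ 1`): `step9Needs` cannot be read off `|φ7.d⟩`, even with error** —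
(W) `Shape.step9Needs_not_almostSurely_measurable_sharp` (`4·ε·Q² < 1`) at the sharp order: no POVM on the
Step-8 register with outcomes in `ℤ_N` returns, on `|φ7.d⟩` of every admissible instance, that instance's
`step9Needs = v′₀ mod N` with weight `≥ (1 − ε)⟨φ7.d|φ7.d⟩`, as soon as `32·ε·p² ≤ 1` for every prime
`p ∣ Q` (`n ≥ 1`).  By (Y) `Shape.step8_povm_ceiling_fails_at_inv_prime_sq` the same-outcome mechanism behind
this is unavailable at `ε = 1/p²` for any `p ∣ Q`; by (R) `Shape.step9Needs_not_almostCertain_third` the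
READ-OUT conclusion itself holds for every `ε ≤ 1/3` by a different (averaging) argument — the present
corollary is the measurement-ceiling route, recorded for comparison with (P)/(W).  HONEST FRAMING: about a
WITHDRAWN algorithm. [cite: ChenQuantumLattice2024, Lemma 3.13 p. 32, §3.5 p. 22, §3.5.9 p. 37] -/
theorem step9Needs_not_almostSurely_measurable_largestPrime (h : S.Admissible) (hn : 0 < S.n) {ε : ℝ}
    (hε : ∀ p ∈ (S.Q : ℕ).primeFactors, 32 * ε * (p : ℝ) ^ 2 ≤ 1)
    (E : POVM (Fin (S.n + 1) → ZMod S.M) (ZMod S.N)) :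
    ¬ ∀ b₂ v₂ : Fin (S.n + 1) → ℤ, (S.inst b₂ v₂).Admissible →
        E.AlmostCertain ε (S.inst b₂ v₂).phi7d (S.inst b₂ v₂).step9Needs := by
  intro H
  have hE : S.AlmostSureOn ε Finset.univ E := fun b₂ v₂ hI => ⟨_, H b₂ v₂ hI.2⟩
  obtain ⟨v₃, h₃, -, hne, hk⟩ := S.step8_cannot_supply_step9Needs_povm_largestPrime' h hn E hε hE
  exact hne (hk _ _ (H S.b S.v' h) (H S.b v₃ h₃)).symm

end Shape


/-! ## Part IX.  The frame LINK: an orthogonal frame and a test box inside its span share their outcome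

The elementary step of Part V pays `32εp² ≤ 1` because a test vector has mass only `1/p²` on each frame.
When the test vectors lie ENTIRELY in the span of one frame (mass `1`) nothing is paid beyond `ε < 1/2`:
the trace of `1 − E_{k₀}` on the span of the frame is at most `ε·a·#frame` computed in the frame, and at
least `(1 − ε)·a·#box` computed on the test box if the box's outcome `k₁` differs from the frame's `k₀`.
This is what links two dummy-slope families of the class (Part XI): a box of the slope-`0` family and the
box of the slope-`e_τ` family over the same `(x, w_τ) ∈ ℤ_Q²` are two orthogonal bases of ONE
`Q²`-dimensional space (all overlaps of modulus² `a²/Q²` — mutually unbiased). -/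

namespace POVM

variable {X : Type*} [Fintype X] [DecidableEq X] {κ : Type*} [Fintype κ] [DecidableEq κ] (E : POVM X κ)

/-- **Frame link.** `O` an orthogonal frame of norm² `a` inside the span of the orthogonal test family
`u` (norm² `a`), all `O_j` with almost-certain outcome `k₀`; `F` a non-empty box of test indices with
`#O ≤ #F`, every `u_v` (`v ∈ F`) of full mass `a²` on the frame (i.e. IN ITS SPAN) and with almost-certain
outcome `k₁`. Then `k₀ = k₁` whenever `ε < 1/2`. [cite: NielsenChuang2010, §2.2.6 p. 90, Box 2.3 p. 87] -/
theorem frame_link {ε a : ℝ} (ha : 0 < a) (hε2 : ε < 1 / 2)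
    {J V : Type*} [Fintype J] [DecidableEq J] [Fintype V] [DecidableEq V]
    (O : J → X → ℂ) (uf : V → X → ℂ)
    (hO : ∀ j j', star (O j) ⬝ᵥ O j' = if j = j' then ((a : ℂ)) else 0)
    (hX : ∀ j, O j = frameProj uf a (O j))
    (F : Finset V) (hFne : F.Nonempty) (hJF : Fintype.card J ≤ F.card)
    (huF : ∀ v ∈ F, star (uf v) ⬝ᵥ uf v = ((a : ℂ)))
    (hM : ∀ v ∈ F, ∑ j, ‖star (O j) ⬝ᵥ uf v‖ ^ 2 = a ^ 2)
    {k₀ k₁ : κ} (hk₀ : ∀ j, E.AlmostCertain ε (O j) k₀) (hk₁ : ∀ v ∈ F, E.AlmostCertain ε (uf v) k₁) :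
    k₀ = k₁ := by
  classical
  by_contra hne
  have hufa : ∀ v ∈ F, (star (uf v) ⬝ᵥ uf v).re = a := fun v hv => by rw [huF v hv, Complex.ofReal_re]
  -- the test vectors of the box lie in the span of the frame
  have hP : ∀ v ∈ F, frameProj O a (uf v) = uf v := fun v hv =>
    (eq_frameProj_of_bessel O ha hO (uf v) (by rw [hM v hv, hufa v hv]; ring)).symm
  set δ : V → ℝ := fun v =>
    (star (frameProj O a (uf v)) ⬝ᵥ ((1 - E.effect k₀) *ᵥ frameProj O a (uf v))).re with hδ
  have hδ0 : ∀ v, 0 ≤ δ v := fun v =>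
    (Complex.nonneg_iff.1 ((E.posSemidef_one_sub k₀).dotProduct_mulVec_nonneg _)).1
  -- on the box the `k₀`-defect is at least `(1 − ε)·a`
  have step1 : ∀ v ∈ F, (1 - ε) * a ≤ δ v := by
    intro v hv
    have h2 := E.weight_re_add_weight_re_le (uf v) (Ne.symm hne)
    have hk := hk₁ v hv
    unfold AlmostCertain at hk
    rw [hufa v hv] at hk h2
    show (1 - ε) * a ≤ (star (frameProj O a (uf v)) ⬝ᵥ ((1 - E.effect k₀) *ᵥ frameProj O a (uf v))).re
    rw [hP v hv, E.dotProduct_one_sub_mulVec, Complex.sub_re, hufa v hv]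
    change (1 - ε) * a ≤ a - (E.weight (uf v) k₀).re
    linarith
  have step2 : (F.card : ℝ) * ((1 - ε) * a) ≤ ∑ v ∈ F, δ v := by
    have h := Finset.sum_le_sum step1
    rwa [Finset.sum_const, nsmul_eq_mul] at h
  -- in the frame the total `k₀`-defect is at most `ε·a·#O`
  have t₀ : ∑ v, δ v ≤ ε * a * Fintype.card J := E.total_defect_le O uf ha hO hX k₀ hk₀
  have s₀ : ∑ v ∈ F, δ v ≤ ∑ v, δ v := Finset.sum_le_univ_sum_of_nonneg hδ0
  have hFpos : (0 : ℝ) < F.card := by exact_mod_cast hFne.card_pos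
  have hJF' : (Fintype.card J : ℝ) ≤ F.card := by exact_mod_cast hJF
  have hFa : 0 < (F.card : ℝ) * a := mul_pos hFpos ha
  have main : (F.card : ℝ) * ((1 - ε) * a) ≤ ε * a * Fintype.card J := step2.trans (s₀.trans t₀)
  rcases le_or_gt 0 ε with hε0 | hε0
  · have h1 : ε * a * (Fintype.card J : ℝ) ≤ ε * a * F.card :=
      mul_le_mul_of_nonneg_left hJF' (by positivity)
    nlinarith [mul_pos (sub_pos.2 hε2) hFa]
  · have h1 : ε * a * (Fintype.card J : ℝ) ≤ 0 := by
      have : (0 : ℝ) ≤ a * Fintype.card J := by positivity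
      nlinarith
    nlinarith

end POVM

/-! ## Part X.  Re-sloping: the dummy-slope-`γ` family of `S` is the straightened family of `S.reslope γ`

`S.reslope γ` is `S` with slopes `famBT univ γ = (−1, b_{t+1} + 2p₁γ_t)` and the same offset: admissible,
with the same coset structure, and — the point — its member `(β; x, ȳ)` is `S`'s member `(γ + β; x, ȳ)`
(slopes agree modulo `P`). So everything Parts V–VI prove for the slope-`0` family of an arbitrary
admissible shape holds for every dummy-slope family of `S`. -/

namespace Shape

variable (S : Shape)

/-- The RE-SLOPED shape `(famBT univ γ, v′)`. [cite: ChenQuantumLattice2024, §3.1 p. 22, Cond. C.3 p. 18] -/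
abbrev reslope (γ : Fin S.n → ZMod S.Q) : Shape := S.inst (S.famBT Finset.univ γ) S.v'

/-- Re-sloping preserves admissibility. [cite: ChenQuantumLattice2024, Cond. C.3 p. 18, eq. (12) p. 17] -/
theorem reslope_admissible (h : S.Admissible) (γ : Fin S.n → ZMod S.Q) : (S.reslope γ).Admissible :=
  S.inst_admissible h (S.famBT_zero _ _)
    (fun i hi => by
      obtain ⟨t, rfl⟩ := Fin.exists_succ_eq.2 hi
      rw [famBT_succ]
      exact dvd_mul_right _ _)
    h.v'_in_DZ

/-- `P = p₁·Q` as integers. [cite: ChenQuantumLattice2024, Cond. C.3 p. 18] -/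
theorem P_int_eq : ((S.P : ℕ) : ℤ) = (S.p₁ : ℤ) * ((S.Q : ℕ) : ℤ) := by
  show ((((S.p₁ * S.Q : ℕ+)) : ℕ) : ℤ) = _
  push_cast
  ring

/-- The slopes of the member `β` of the re-sloped shape and of the member `γ + β` of `S` agree modulo `P`
(indeed modulo `2P`: the dummy values are read modulo `Q`). [cite: ChenQuantumLattice2024, §3.1 p. 22] -/
theorem famBT_reslope_congr (γ β : Fin S.n → ZMod S.Q) (i : Fin (S.n + 1)) :
    ((S.P : ℕ) : ℤ) ∣ (S.reslope γ).famBT Finset.univ β i - S.famBT Finset.univ (γ + β) i := by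
  refine Fin.cases ?_ (fun t => ?_) i
  · rw [famBT_zero, famBT_zero, sub_self]
    exact dvd_zero _
  · have hp0 : (2 * (S.p₁ : ℤ)) ≠ 0 := by
      have : (0 : ℤ) < S.p₁ := by exact_mod_cast S.p₁.pos
      positivity
    have hB1 : (S.reslope γ).BfamT Finset.univ β t
        = S.b t.succ / (2 * (S.p₁ : ℤ)) + ((γ t).val : ℤ) + ((β t).val : ℤ) := by
      show S.famBT Finset.univ γ t.succ / (2 * (S.p₁ : ℤ))
          + (if t ∈ Finset.univ then ((β t).val : ℤ) else 0) = _
      rw [famBT_succ, Int.mul_ediv_cancel_left _ hp0]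
      unfold BfamT
      simp only [Finset.mem_univ, if_true]
    have hB2 : S.BfamT Finset.univ (γ + β) t = S.b t.succ / (2 * (S.p₁ : ℤ)) + (((γ + β) t).val : ℤ) := by
      unfold BfamT
      simp only [Finset.mem_univ, if_true]
    have hva : (((γ + β) t).val : ℤ)
        + ((S.Q : ℕ) : ℤ) * (((((γ t).val + (β t).val) / (S.Q : ℕ) : ℕ)) : ℤ)
          = ((γ t).val : ℤ) + ((β t).val : ℤ) := by
      have h1 := Nat.mod_add_div ((γ t).val + (β t).val) (S.Q : ℕ)
      rw [Pi.add_apply, ZMod.val_add]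
      exact_mod_cast h1
    rw [famBT_succ, famBT_succ, hB1, hB2, S.P_int_eq,
      show (((S.reslope γ).p₁ : ℕ) : ℤ) = (S.p₁ : ℤ) from rfl]
    exact ⟨2 * (((((γ t).val + (β t).val) / (S.Q : ℕ) : ℕ)) : ℤ), by linear_combination (-2 * (S.p₁ : ℤ)) * hva⟩

/-- **The member `β` of the re-sloped shape is the member `γ + β` of `S`.**
[cite: ChenQuantumLattice2024, §3.1 p. 22, eq. (35) p. 31, §3.5.8 pp. 32–33] -/
theorem uKet_reslope (γ β : Fin S.n → ZMod S.Q) (x : ZMod S.Q)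
    (yb : Fin S.n → ZMod S.Q) : (S.reslope γ).uKet β x yb = S.uKet (γ + β) x yb := by
  show (S.inst ((S.reslope γ).famBT Finset.univ β) (S.vOf (S.xyv x yb))).phi7d
      = (S.inst (S.famBT Finset.univ (γ + β)) (S.vOf (S.xyv x yb))).phi7d
  exact S.phi7d_inst_congr_b _ fun i => S.famBT_reslope_congr γ β i

/-- The straightening slopes of the re-sloped shape: `b̄′ = b̄ + 2p₁·γ`. [cite: ChenQuantumLattice2024, Cond. C.3 p. 18] -/
theorem bbar_reslope (h : S.Admissible) (γ : Fin S.n → ZMod S.Q) (t : Fin S.n) :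
    (S.reslope γ).bbar t = S.bbar t + 2 * ((S.p₁ : ℕ) : ZMod S.Q) * γ t := by
  show ((S.famBT Finset.univ γ t.succ : ℤ) : ZMod S.Q) = _
  rw [famBT_succ]
  unfold BfamT
  simp only [Finset.mem_univ, if_true, Int.cast_mul, Int.cast_add, Int.cast_ofNat, Int.cast_natCast,
    ZMod.natCast_zmod_val]
  rw [← S.two_p₁_mul_bhalf h t]
  ring

/-- The dummy family `γ` of `S`, member `(x, ȳ)`, is the straightened member `Z_{x, ȳ + x·b̄′}` of the
re-sloped shape. [cite: ChenQuantumLattice2024, eq. (35) p. 31] -/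
theorem uKet_eq_reslope_zKet (γ : Fin S.n → ZMod S.Q) (x : ZMod S.Q)
    (yb : Fin S.n → ZMod S.Q) :
    S.uKet γ x yb = (S.reslope γ).zKet x (yb + x • (S.reslope γ).bbar) := by
  show _ = (S.reslope γ).uKet 0 x (yb + x • (S.reslope γ).bbar - x • (S.reslope γ).bbar)
  rw [S.uKet_reslope, add_zero, add_sub_cancel_right]

/-- The dummy family `γ + e_τ` of `S`, member `(x, ȳ)`, is the test vector `u^τ_{x, ȳ + x·b̄′}` (slope
`1·e_τ`) of the re-sloped shape. [cite: ChenQuantumLattice2024, §3.1 p. 22, eq. (35) p. 31] -/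
theorem uKet_add_single_eq_reslope_tKet (γ : Fin S.n → ZMod S.Q) (τ : Fin S.n)
    (x : ZMod S.Q) (yb : Fin S.n → ZMod S.Q) :
    S.uKet (γ + Pi.single τ 1) x yb = (S.reslope γ).tKet τ 1 x (yb + x • (S.reslope γ).bbar) := by
  show _ = (S.reslope γ).uKet (Pi.single τ ((1 : ℕ) : ZMod S.Q)) x
    (yb + x • (S.reslope γ).bbar - x • (S.reslope γ).bbar)
  rw [Nat.cast_one, add_sub_cancel_right, S.uKet_reslope]

/-- The test vectors `u^τ_{x,w}` (slope `e_τ`) of `S` are the straightened members of `S.reslope e_τ`.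
[cite: ChenQuantumLattice2024, §3.1 p. 22, eq. (35) p. 31] -/
theorem tKet_one_eq_reslope_zKet (τ : Fin S.n) (x : ZMod S.Q)
    (w : Fin S.n → ZMod S.Q) :
    S.tKet τ 1 x w = (S.reslope (Pi.single τ 1)).zKet x
      (w - x • S.bbar + x • (S.reslope (Pi.single τ 1)).bbar) := by
  show S.uKet (Pi.single τ ((1 : ℕ) : ZMod S.Q)) x (w - x • S.bbar) = _
  rw [Nat.cast_one, S.uKet_eq_reslope_zKet]

/-- Class membership transports to the re-sloped shape (`γ` on the unknown coordinates).
[cite: ChenQuantumLattice2024, Lemma 3.13 p. 32, Cond. C.3 p. 18] -/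
theorem hmem_reslope {T : Finset (Fin S.n)} {κ : Type*} [Fintype κ]
    {E : POVM (Fin (S.n + 1) → ZMod S.M) κ} {ε : ℝ}
    (hmem : ∀ (β : Fin S.n → ZMod S.Q) (x : ZMod S.Q) (yb : Fin S.n → ZMod S.Q),
      (∀ t, t ∉ T → β t = 0) → ∃ k, E.AlmostCertain ε (S.uKet β x yb) k)
    {γ : Fin S.n → ZMod S.Q} (hγ : ∀ t, t ∉ T → γ t = 0) :
    ∀ (β : Fin S.n → ZMod S.Q) (x : ZMod S.Q) (yb : Fin S.n → ZMod S.Q),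
      (∀ t, t ∉ T → β t = 0) → ∃ k, E.AlmostCertain ε ((S.reslope γ).uKet β x yb) k := by
  intro β x yb hβ
  rw [S.uKet_reslope]
  exact hmem (γ + β) x yb fun t ht => by rw [Pi.add_apply, hγ t ht, hβ t ht, add_zero]

/-- `ε < 1/2` under the sharp tolerance hypothesis (`Q ≥ 3` has a prime factor `≥ 2`).
[cite: ChenQuantumLattice2024, Cond. C.3 p. 18] -/
theorem eps_lt_half_of_primeFactors (h : S.Admissible) {ε : ℝ}
    (hε : ∀ p ∈ (S.Q : ℕ).primeFactors, 32 * ε * (p : ℝ) ^ 2 ≤ 1) : ε < 1 / 2 := by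
  have hQ1 : 1 < (S.Q : ℕ) := lt_of_lt_of_le (by norm_num) h.three_le_Q
  have hm : (S.Q : ℕ).minFac ∈ (S.Q : ℕ).primeFactors :=
    Nat.mem_primeFactors.2 ⟨Nat.minFac_prime hQ1.ne', Nat.minFac_dvd _, S.Q.ne_zero⟩
  have h1 := hε _ hm
  have h2 : (2 : ℝ) ≤ (S.Q : ℕ).minFac := by exact_mod_cast (Nat.minFac_prime hQ1.ne').two_le
  nlinarith

end Shape

/-! ## Part XI.  Slope invariance: every dummy-slope family of the class carries the outcome of the class

(1) LINK STEP (`link_step`): for an admissible shape whose straightened family is outcome-invariant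
(Part V at `H = Q`) and whose slope-`e_τ` test family is outcome-invariant too, the two invariant outcomes
coincide — Part IX's frame link with the `Q^{1+#T}`-box of straightened members as the frame and the same
box of test vectors `u^τ_v` (slope `1·e_τ`, `G′ = 1`, `H′ = Q`) as the test box: each test vector has full
mass on the frame (`sum_orbit_normSq` at `H₀ = H′ = Q`), each frame member lies in the span of the test
family (Bessel), cost `ε < 1/2` only.
(2) The test family of `S` IS the straightened family of `S.reslope e_τ` (Part X), so it is invariant by
Part V applied to that shape (`sameOut_tKet_one`); hence the BUMP `γ ↦ γ + e_τ` preserves the outcome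
(`sameOut_bump`, Part V + (1) applied to `S.reslope γ`), and by induction over the dummy values and the
unknown coordinates EVERY member `(β; x, ȳ)` of the class (`β` on the unknown coordinates) has the outcome
of the straightened member with the same known coordinates (`sameOut_uKet`). -/

namespace Shape

variable (S : Shape)

/-- **Link step:** the invariant outcome of the straightened family equals the invariant outcome of the
slope-`e_τ` test family (same known coordinates), at cost `ε < 1/2` — the two `ℤ_Q^{1+#T}`-boxes are
orthogonal bases of one space. [cite: ChenQuantumLattice2024, Lemma 3.13 pp. 32–34, eq. (35) p. 31;
NielsenChuang2010, §2.2.6 p. 90, Box 2.3 p. 87] -/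
theorem link_step (h : S.Admissible) {T : Finset (Fin S.n)} {κ : Type*} [Fintype κ] [DecidableEq κ]
    (E : POVM (Fin (S.n + 1) → ZMod S.M) κ) {ε : ℝ} (hε2 : ε < 1 / 2)
    (hmem : ∀ (β : Fin S.n → ZMod S.Q) (x : ZMod S.Q) (yb : Fin S.n → ZMod S.Q),
      (∀ t, t ∉ T → β t = 0) → ∃ k, E.AlmostCertain ε (S.uKet β x yb) k)
    (hInv : S.OutInv T E ε (S.Q : ℕ)) (τ : Fin S.n) (hτ : τ ∈ T)
    (hfam : ∀ (x₁ x₂ : ZMod S.Q) (w₁ w₂ : Fin S.n → ZMod S.Q), (∀ t, t ∉ T → w₁ t = w₂ t) →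
      ∀ k₁ k₂ : κ, E.AlmostCertain ε (S.tKet τ 1 x₁ w₁) k₁ → E.AlmostCertain ε (S.tKet τ 1 x₂ w₂) k₂ →
        k₁ = k₂)
    {x x' : ZMod S.Q} {w w' : Fin S.n → ZMod S.Q} (hw : ∀ t, t ∉ T → w t = w' t) {k k' : κ}
    (hk : E.AlmostCertain ε (S.zKet x w) k) (hk' : E.AlmostCertain ε (S.tKet τ 1 x' w') k') :
    k = k' := by
  classical
  have ha : 0 < S.frameNormSq / ((S.Q : ℕ) : ℝ) ^ S.n := S.frameNormSq_div_pos
  have hQ : (S.Q : ℕ) = 1 * (S.Q : ℕ) := (one_mul _).symm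
  have hQ0 : ((S.Q : ℕ) : ZMod S.Q) = 0 := ZMod.natCast_self _
  -- the frame: the box of straightened members with the known coordinates of `w`
  have horth : ∀ j j' : ↥(box (S.Q : ℕ) (orbW T (S.Q : ℕ)) x w),
      star (S.zKet j.1.1 j.1.2) ⬝ᵥ S.zKet j'.1.1 j'.1.2
        = if j = j' then (((S.frameNormSq / ((S.Q : ℕ) : ℝ) ^ S.n : ℝ)) : ℂ) else 0 := by
    intro j j'
    rw [S.star_zKet_dotProduct_zKet h]
    by_cases hjj : j = j'
    · subst hjj; rw [if_pos ⟨rfl, rfl⟩, if_pos rfl]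
    · rw [if_neg hjj, if_neg]
      rintro ⟨h1, h2⟩
      exact hjj (Subtype.ext (Prod.ext h1 h2))
  have huf : ∀ v v' : ZMod S.Q × (Fin S.n → ZMod S.Q),
      star (S.tKet τ 1 v.1 v.2) ⬝ᵥ S.tKet τ 1 v'.1 v'.2
        = if v = v' then (((S.frameNormSq / ((S.Q : ℕ) : ℝ) ^ S.n : ℝ)) : ℂ) else 0 := by
    intro v v'
    rw [S.star_tKet_dotProduct_tKet h]
    by_cases hvv : v = v'
    · subst hvv; rw [if_pos ⟨rfl, rfl⟩, if_pos rfl]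
    · rw [if_neg hvv, if_neg]
      rintro ⟨h1, h2⟩
      exact hvv (Prod.ext h1 h2)
  have hX : ∀ j : ↥(box (S.Q : ℕ) (orbW T (S.Q : ℕ)) x w), S.zKet j.1.1 j.1.2
      = frameProj (fun v : ZMod S.Q × (Fin S.n → ZMod S.Q) => S.tKet τ 1 v.1 v.2)
          (S.frameNormSq / ((S.Q : ℕ) : ℝ) ^ S.n) (S.zKet j.1.1 j.1.2) :=
    fun j => eq_frameProj_of_bessel _ ha huf _ (S.sum_normSq_tKet_zKet h hQ τ _ _)
  -- membership in the box = agreement of the known coordinates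
  have hmemJ : ∀ v : ZMod S.Q × (Fin S.n → ZMod S.Q),
      v ∈ box (S.Q : ℕ) (orbW T (S.Q : ℕ)) x w ↔ ∀ t, t ∉ T → v.2 t = w t := by
    intro v
    rw [mem_box]
    constructor
    · rintro ⟨-, h2⟩ t ht
      have h3 := h2 t
      rwa [orbW_of_not_mem _ ht, Nat.cast_one, one_mul, sub_eq_zero] at h3
    · intro hv
      refine ⟨by rw [hQ0, zero_mul], fun t => ?_⟩
      by_cases ht : t ∈ T
      · rw [orbW_of_mem _ ht, hQ0, zero_mul]
      · rw [orbW_of_not_mem _ ht, Nat.cast_one, one_mul, sub_eq_zero]; exact hv t ht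
  have hF' : (x', w') ∈ box (S.Q : ℕ) (orbW T (S.Q : ℕ)) x w := (hmemJ _).2 fun t ht => (hw t ht).symm
  -- full mass of every test vector of the box on the frame
  have hM : ∀ v ∈ box (S.Q : ℕ) (orbW T (S.Q : ℕ)) x w,
      ∑ j : ↥(box (S.Q : ℕ) (orbW T (S.Q : ℕ)) x w), ‖star (S.zKet j.1.1 j.1.2) ⬝ᵥ S.tKet τ 1 v.1 v.2‖ ^ 2
        = (S.frameNormSq / ((S.Q : ℕ) : ℝ) ^ S.n) ^ 2 := by
    intro v hv
    have hoff := (hmemJ v).1 hv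
    rw [Finset.sum_coe_sort (box (S.Q : ℕ) (orbW T (S.Q : ℕ)) x w)
        (fun j => ‖star (S.zKet j.1 j.2) ⬝ᵥ S.tKet τ 1 v.1 v.2‖ ^ 2),
      S.sum_orbit_normSq h (G' := 1) (p := 1) (H₀ := (S.Q : ℕ)) (H' := (S.Q : ℕ)) (one_mul _).symm hQ hτ
        x w v (by rw [hQ0, zero_mul]) (by rw [hQ0, zero_mul]) (fun t _ _ => by rw [hQ0, zero_mul]) hoff]
    have hQr : ((S.Q : ℕ) : ℝ) ≠ 0 := by exact_mod_cast S.Q.ne_zero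
    field_simp
  -- outcomes: `k` on the frame (straightened invariance), `k'` on the test box (test-family invariance)
  have hkJ : ∀ j : ↥(box (S.Q : ℕ) (orbW T (S.Q : ℕ)) x w), E.AlmostCertain ε (S.zKet j.1.1 j.1.2) k := by
    intro j
    obtain ⟨kj, hkj⟩ := hmem 0 j.1.1 (j.1.2 - j.1.1 • S.bbar) (fun _ _ => rfl)
    have hoff := (hmemJ j.1).1 j.2
    have he := hInv x j.1.1 w j.1.2 (by rw [hQ0, zero_mul]) (fun t _ => by rw [hQ0, zero_mul])
      (fun t ht => (hoff t ht).symm) k kj hk hkj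
    rw [he]; exact hkj
  have hkF : ∀ v ∈ box (S.Q : ℕ) (orbW T (S.Q : ℕ)) x w, E.AlmostCertain ε (S.tKet τ 1 v.1 v.2) k' := by
    intro v hv
    obtain ⟨kv, hkv⟩ := hmem (Pi.single τ ((1 : ℕ) : ZMod S.Q)) v.1 (v.2 - v.1 • S.bbar) fun t ht =>
      Pi.single_eq_of_ne (ne_of_mem_of_not_mem hτ ht).symm _
    have hoff := (hmemJ v).1 hv
    have he := hfam v.1 x' v.2 w' (fun t ht => by rw [hoff t ht, hw t ht]) kv k' hkv hk'
    rw [← he]; exact hkv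
  exact E.frame_link ha hε2 (fun j : ↥(box (S.Q : ℕ) (orbW T (S.Q : ℕ)) x w) => S.zKet j.1.1 j.1.2)
    (fun v : ZMod S.Q × (Fin S.n → ZMod S.Q) => S.tKet τ 1 v.1 v.2) horth hX
    (box (S.Q : ℕ) (orbW T (S.Q : ℕ)) x w) ⟨_, hF'⟩ (by rw [Fintype.card_coe])
    (fun v _ => by rw [huf, if_pos rfl]) hM hkJ hkF

/-- **The slope-`e_τ` test family is outcome-invariant** (equal known coordinates ⇒ equal outcome): it is
the straightened family of `S.reslope e_τ`, to which Part V applies.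
[cite: ChenQuantumLattice2024, Lemma 3.13 pp. 32–34, §3.1 p. 22] -/
theorem sameOut_tKet_one (h : S.Admissible) {T : Finset (Fin S.n)} (hTne : T.Nonempty) {κ : Type*}
    [Fintype κ] [DecidableEq κ] (E : POVM (Fin (S.n + 1) → ZMod S.M) κ) {ε : ℝ}
    (hmem : ∀ (β : Fin S.n → ZMod S.Q) (x : ZMod S.Q) (yb : Fin S.n → ZMod S.Q),
      (∀ t, t ∉ T → β t = 0) → ∃ k, E.AlmostCertain ε (S.uKet β x yb) k)
    (hε : ∀ p ∈ (S.Q : ℕ).primeFactors, 32 * ε * (p : ℝ) ^ 2 ≤ 1) {τ : Fin S.n} (hτ : τ ∈ T)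
    (x₁ x₂ : ZMod S.Q) {w₁ w₂ : Fin S.n → ZMod S.Q} (hoff : ∀ t, t ∉ T → w₁ t = w₂ t) {k₁ k₂ : κ}
    (hk₁ : E.AlmostCertain ε (S.tKet τ 1 x₁ w₁) k₁) (hk₂ : E.AlmostCertain ε (S.tKet τ 1 x₂ w₂) k₂) :
    k₁ = k₂ := by
  have hγ : ∀ t, t ∉ T → (Pi.single τ 1 : Fin S.n → ZMod S.Q) t = 0 := fun t ht =>
    Pi.single_eq_of_ne (ne_of_mem_of_not_mem hτ ht).symm _
  rw [S.tKet_one_eq_reslope_zKet] at hk₁ hk₂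
  refine (S.reslope (Pi.single τ 1)).sameOut_zKet (S.reslope_admissible h _) hTne E
    (S.hmem_reslope hmem hγ) hε x₁ x₂ (fun t ht => ?_) hk₁ hk₂
  have htτ : t ≠ τ := fun h' => ht (h' ▸ hτ)
  simp only [Pi.add_apply, Pi.sub_apply, Pi.smul_apply, smul_eq_mul, S.bbar_reslope h,
    Pi.single_eq_of_ne htτ, mul_zero, add_zero, hoff t ht, sub_add_cancel]

/-- **The bump `γ ↦ γ + e_τ` preserves the outcome** (members with the same known straightened
coordinates `ȳ_t + x·b̄_t`, `t ∉ T`). [cite: ChenQuantumLattice2024, Lemma 3.13 pp. 32–34, §3.1 p. 22] -/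
theorem sameOut_bump (h : S.Admissible) {T : Finset (Fin S.n)} (hTne : T.Nonempty) {κ : Type*}
    [Fintype κ] [DecidableEq κ] (E : POVM (Fin (S.n + 1) → ZMod S.M) κ) {ε : ℝ}
    (hmem : ∀ (β : Fin S.n → ZMod S.Q) (x : ZMod S.Q) (yb : Fin S.n → ZMod S.Q),
      (∀ t, t ∉ T → β t = 0) → ∃ k, E.AlmostCertain ε (S.uKet β x yb) k)
    (hε : ∀ p ∈ (S.Q : ℕ).primeFactors, 32 * ε * (p : ℝ) ^ 2 ≤ 1) {τ : Fin S.n} (hτ : τ ∈ T)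
    {γ : Fin S.n → ZMod S.Q} (hγ : ∀ t, t ∉ T → γ t = 0) (x₁ x₂ : ZMod S.Q)
    {yb₁ yb₂ : Fin S.n → ZMod S.Q} (hcls : ∀ t, t ∉ T → yb₁ t + x₁ * S.bbar t = yb₂ t + x₂ * S.bbar t)
    {k₁ k₂ : κ} (hk₁ : E.AlmostCertain ε (S.uKet (γ + Pi.single τ 1) x₁ yb₁) k₁)
    (hk₂ : E.AlmostCertain ε (S.uKet γ x₂ yb₂) k₂) : k₁ = k₂ := by
  have hε2 : ε < 1 / 2 := S.eps_lt_half_of_primeFactors h hε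
  have h' : (S.reslope γ).Admissible := S.reslope_admissible h γ
  have hmem' := S.hmem_reslope hmem hγ
  have hInv' : (S.reslope γ).OutInv T E ε ((S.reslope γ).Q : ℕ) :=
    (S.reslope γ).outInv_of_dvd h' hTne E hmem' hε _ dvd_rfl
  rw [S.uKet_add_single_eq_reslope_tKet] at hk₁
  rw [S.uKet_eq_reslope_zKet γ] at hk₂
  refine ((S.reslope γ).link_step h' E hε2 hmem' hInv' τ hτ
    (fun x₁ x₂ w₁ w₂ hoff k₁ k₂ hk₁ hk₂ =>
      (S.reslope γ).sameOut_tKet_one h' hTne E hmem' hε hτ x₁ x₂ hoff hk₁ hk₂)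
    (fun t ht => ?_) hk₂ hk₁).symm
  simp only [Pi.add_apply, Pi.smul_apply, smul_eq_mul, S.bbar_reslope h, hγ t ht, mul_zero, add_zero]
  exact (hcls t ht).symm

/-- **Slope invariance of the outcome on the class:** every member `(β; x, ȳ)` of the class (`β` on the
unknown coordinates) has the almost-certain outcome of any straightened member `Z_{x′,w′}` with the same
known coordinates (`ȳ_t + x·b̄_t = w′_t`, `t ∉ T`), under `32·ε·p² ≤ 1` for the primes `p ∣ Q` — by
induction over the unknown coordinates and the dummy values, one bump at a time.
[cite: ChenQuantumLattice2024, Lemma 3.13 pp. 32–34, §3.1 p. 22, §3.5.8 pp. 33–34] -/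
theorem sameOut_uKet (h : S.Admissible) {T : Finset (Fin S.n)} (hTne : T.Nonempty) {κ : Type*}
    [Fintype κ] [DecidableEq κ] (E : POVM (Fin (S.n + 1) → ZMod S.M) κ) {ε : ℝ}
    (hmem : ∀ (β : Fin S.n → ZMod S.Q) (x : ZMod S.Q) (yb : Fin S.n → ZMod S.Q),
      (∀ t, t ∉ T → β t = 0) → ∃ k, E.AlmostCertain ε (S.uKet β x yb) k)
    (hε : ∀ p ∈ (S.Q : ℕ).primeFactors, 32 * ε * (p : ℝ) ^ 2 ≤ 1)
    {β : Fin S.n → ZMod S.Q} (hβ : ∀ t, t ∉ T → β t = 0) (x₁ x₂ : ZMod S.Q)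
    {yb₁ w₂ : Fin S.n → ZMod S.Q} (hcls : ∀ t, t ∉ T → yb₁ t + x₁ * S.bbar t = w₂ t) {k₁ k₂ : κ}
    (hk₁ : E.AlmostCertain ε (S.uKet β x₁ yb₁) k₁) (hk₂ : E.AlmostCertain ε (S.zKet x₂ w₂) k₂) :
    k₁ = k₂ := by
  classical
  -- slope `0`: Part V
  have base : ∀ (x : ZMod S.Q) (yb : Fin S.n → ZMod S.Q) (k : κ),
      (∀ t, t ∉ T → yb t + x * S.bbar t = w₂ t) → E.AlmostCertain ε (S.uKet 0 x yb) k → k = k₂ := by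
    intro x yb k hc hk
    have hz : S.uKet 0 x yb = S.zKet x (yb + x • S.bbar) := by
      rw [Shape.zKet, add_sub_cancel_right]
    rw [hz] at hk
    exact S.sameOut_zKet h hTne E hmem hε x x₂
      (fun t ht => by rw [Pi.add_apply, Pi.smul_apply, smul_eq_mul]; exact hc t ht) hk hk₂
  -- one bump
  have bump : ∀ (γ : Fin S.n → ZMod S.Q), (∀ t, t ∉ T → γ t = 0) → ∀ τ ∈ T,
      (∀ (x : ZMod S.Q) (yb : Fin S.n → ZMod S.Q) (k : κ), (∀ t, t ∉ T → yb t + x * S.bbar t = w₂ t) →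
        E.AlmostCertain ε (S.uKet γ x yb) k → k = k₂) →
      ∀ (x : ZMod S.Q) (yb : Fin S.n → ZMod S.Q) (k : κ), (∀ t, t ∉ T → yb t + x * S.bbar t = w₂ t) →
        E.AlmostCertain ε (S.uKet (γ + Pi.single τ 1) x yb) k → k = k₂ := by
    intro γ hγ τ hτ hP x yb k hc hk
    obtain ⟨k', hk'⟩ := hmem γ x yb hγ
    rw [← hP x yb k' hc hk']
    exact S.sameOut_bump h hTne E hmem hε hτ hγ x x (fun _ _ => rfl) hk hk'
  -- `N` bumps at one coordinate
  have bumpN : ∀ (N : ℕ) (γ : Fin S.n → ZMod S.Q), (∀ t, t ∉ T → γ t = 0) → ∀ τ ∈ T,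
      (∀ (x : ZMod S.Q) (yb : Fin S.n → ZMod S.Q) (k : κ), (∀ t, t ∉ T → yb t + x * S.bbar t = w₂ t) →
        E.AlmostCertain ε (S.uKet γ x yb) k → k = k₂) →
      ∀ (x : ZMod S.Q) (yb : Fin S.n → ZMod S.Q) (k : κ), (∀ t, t ∉ T → yb t + x * S.bbar t = w₂ t) →
        E.AlmostCertain ε (S.uKet (γ + Pi.single τ ((N : ℕ) : ZMod S.Q)) x yb) k → k = k₂ := by
    intro N
    induction N with
    | zero =>
      intro γ hγ τ hτ hP x yb k hc hk
      rw [Nat.cast_zero, Pi.single_zero, add_zero] at hk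
      exact hP x yb k hc hk
    | succ N ih =>
      intro γ hγ τ hτ hP x yb k hc hk
      have e1 : (Pi.single τ (((N + 1 : ℕ)) : ZMod S.Q) : Fin S.n → ZMod S.Q)
          = Pi.single τ ((N : ℕ) : ZMod S.Q) + Pi.single τ 1 := by
        rw [← Pi.single_add, Nat.cast_succ]
      rw [e1, ← add_assoc] at hk
      have hP' := ih γ hγ τ hτ hP
      have hγ' : ∀ t, t ∉ T → (γ + Pi.single τ ((N : ℕ) : ZMod S.Q) : Fin S.n → ZMod S.Q) t = 0 :=
          fun t ht => by
        rw [Pi.add_apply, hγ t ht, Pi.single_eq_of_ne (ne_of_mem_of_not_mem hτ ht).symm, add_zero]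
      exact bump _ hγ' τ hτ hP' x yb k hc hk
  -- induction over the support of `β`
  have main : ∀ (A : Finset (Fin S.n)), A ⊆ T → ∀ (γ : Fin S.n → ZMod S.Q), (∀ t, t ∉ A → γ t = 0) →
      ∀ (x : ZMod S.Q) (yb : Fin S.n → ZMod S.Q) (k : κ), (∀ t, t ∉ T → yb t + x * S.bbar t = w₂ t) →
        E.AlmostCertain ε (S.uKet γ x yb) k → k = k₂ := by
    intro A
    induction A using Finset.induction_on with
    | empty =>
      intro _ γ hγ x yb k hc hk
      have h0 : γ = 0 := funext fun t => hγ t (Finset.notMem_empty t)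
      rw [h0] at hk
      exact base x yb k hc hk
    | insert τ A hτA ih =>
      intro hsub γ hγ x yb k hc hk
      have hτT : τ ∈ T := hsub (Finset.mem_insert_self τ A)
      have hAT : A ⊆ T := fun s hs => hsub (Finset.mem_insert_of_mem hs)
      have hγ'A : ∀ t, t ∉ A → Function.update γ τ 0 t = 0 := by
        intro t ht
        by_cases htτ : t = τ
        · rw [htτ, Function.update_self]
        · rw [Function.update_of_ne htτ]
          exact hγ t (by rw [Finset.mem_insert, not_or]; exact ⟨htτ, ht⟩)
      have hdec : γ = Function.update γ τ 0 + Pi.single τ ((((γ τ).val : ℕ)) : ZMod S.Q) := by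
        rw [ZMod.natCast_zmod_val]
        funext t
        by_cases htτ : t = τ
        · rw [htτ, Pi.add_apply, Function.update_self, Pi.single_eq_same, zero_add]
        · rw [Pi.add_apply, Function.update_of_ne htτ, Pi.single_eq_of_ne htτ, add_zero]
      rw [hdec] at hk
      exact bumpN (γ τ).val (Function.update γ τ 0) (fun t ht => hγ'A t fun htA => ht (hAT htA)) τ hτT
        (ih hAT (Function.update γ τ 0) hγ'A) x yb k hc hk
  exact main T (subset_refl T) β hβ x₁ yb₁ k₁ hcls hk₁

end Shape

/-! ## Part XII.  The robust ceiling for EVERY pair of class instances at the sharp tolerance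

With Part XI the restriction "same unknown slopes" of Part VII disappears: two instances `(b₂, v₂)`,
`(b₃, v₃)` of the class `InClass U` with `v₃ ≡ v₂ + 2D²p₁·(a·b₂ + m) (mod M)` (`m` on the unknown
coordinates) — exactly the pairs of `Shape.step8_povm_ceiling_sharp` of
`ChenQuantumLWEMeasurementThreshold` (tolerance `4·ε·Q² < 1` there) — receive the same almost-certain
outcome as soon as `32·ε·p² ≤ 1` for every prime `p ∣ Q`. The slopes `b₃` are a dummy family
`famBT univ β` of `(b₂, v₂)` modulo `P` with `β` on the unknown coordinates, so `|φ7.d(b₃, v₃)⟩` is the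
member `(β; x₀ − a, ȳ₀ + a·b̄ + m̄)` of the base class and Part XI applies. -/

namespace Shape

variable (S : Shape)

/-- **Shifting the offset by `L·e` within a dummy family:** `|φ7.d(famBT univ β; v′ + L·e)⟩` is the
member `(β; q₀ + e₀, (q_{t+1} + e_{t+1})_t)` of the base class of `S`'s coset (`v′ = D·c + L·q`) — the
dummy-slope version of `phi7d_inst_shift_eq_uKet`. [cite: ChenQuantumLattice2024, eq. (35) p. 31, §3.1 p. 22] -/
theorem phi7d_inst_famBT_shift_eq_uKet (h : S.Admissible) (β : Fin S.n → ZMod S.Q)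
    (e : Fin (S.n + 1) → ℤ) :
    (S.inst (S.famBT Finset.univ β) (fun i => S.v' i + S.L * e i)).phi7d
      = (S.cshape (S.cosetOf S.v')).uKet β (((S.quotOf S.v' 0 + e 0 : ℤ)) : ZMod S.Q)
          (fun t => (((S.quotOf S.v' t.succ + e t.succ : ℤ)) : ZMod S.Q)) := by
  set c := S.cosetOf S.v' with hc
  set x : ZMod S.Q := (((S.quotOf S.v' 0 + e 0 : ℤ)) : ZMod S.Q) with hx
  set yb : Fin S.n → ZMod S.Q := fun t => (((S.quotOf S.v' t.succ + e t.succ : ℤ)) : ZMod S.Q)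
    with hyb
  -- the slopes are literally the same
  have hb : ∀ i, ((S.P : ℕ) : ℤ) ∣ S.famBT Finset.univ β i - (S.cshape c).famBT Finset.univ β i := by
    intro i
    rw [show (S.cshape c).famBT Finset.univ β i = S.famBT Finset.univ β i from rfl, sub_self]
    exact dvd_zero _
  -- the offsets agree modulo `M`
  have hq' : ∀ i, S.vrep c i + S.L * S.quotOf S.v' i = S.v' i := fun i =>
    S.vrep_cosetOf_add h.v'_in_DZ i
  have hr : ∀ i, ((S.cshape c).xyv x yb i : ℤ) = (S.quotOf S.v' i + e i) % ((S.Q : ℕ) : ℤ) := by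
    intro i
    refine Fin.cases ?_ (fun t => ?_) i
    · rw [xyv_zero, hx]; exact ZMod.val_intCast _
    · rw [xyv_succ, hyb]; exact ZMod.val_intCast _
  have hv : ∀ i, (((fun i => S.v' i + S.L * e i) i : ℤ) : ZMod S.M)
      = ((((S.cshape c).vOf ((S.cshape c).xyv x yb) i : ℤ)) : ZMod S.M) := by
    intro i
    rw [ZMod.intCast_eq_intCast_iff_dvd_sub, vOf_apply, S.M_eq_L_mul_Q]
    show S.L * ((S.Q : ℕ) : ℤ) ∣ S.vrep c i + S.L * ((S.cshape c).xyv x yb i : ℤ) - (S.v' i + S.L * e i)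
    rw [hr i]
    have hsq := Int.mul_ediv_add_emod (S.quotOf S.v' i + e i) ((S.Q : ℕ) : ℤ)
    exact ⟨-((S.quotOf S.v' i + e i) / ((S.Q : ℕ) : ℤ)), by linear_combination hq' i + S.L * hsq⟩
  exact (S.phi7d_inst_congr_b (fun i => S.v' i + S.L * e i) hb).trans
    (phi7d_inst_congr (S := S) ((S.cshape c).famBT Finset.univ β)
      ((S.cshape c).vOf ((S.cshape c).xyv x yb)) (fun i => S.v' i + S.L * e i) hv)

/-- **THE ROBUST CEILING FOR ALL PAIRS at the sharp tolerance** — the statement of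
`Shape.step8_povm_ceiling_sharp` with `4·ε·Q² < 1` replaced by `32·ε·p² ≤ 1` for the primes `p ∣ Q`: for
every set `U` of unknown coordinates containing a tail coordinate, every POVM `ε`-almost sure on the
class `InClass U`, and every two class instances `(b₂, v₂)`, `(b₃, v₃)` (ANY admissible unknown slopes
`b₃`) whose offsets satisfy `v₃ ≡ v₂ + 2D²p₁·(a·b₂ + m) (mod M)` with `m` supported on the unknown
coordinates, the two almost-certain outcomes coincide. With the failure at `ε = 1/p²`
(`Shape.step8_povm_ceiling_fails_at_inv_prime_sq`): the tolerance threshold of the Step-8 robust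
ceiling — all pairs, all admissible `Q` — is `Θ(1/𝔭(Q)²)`, constants in `[1/32, 1]`.
HONEST FRAMING: a theorem about one step of a WITHDRAWN algorithm; no repair, no attack.
[cite: ChenQuantumLattice2024, Lemma 3.13 pp. 32–34, eq. (12) p. 17, eq. (35) p. 31, §3.5.8 pp. 33–34,
§3.5.9 p. 37; NielsenChuang2010, §2.2.6 p. 90, Box 2.3 p. 87] -/
theorem step8_povm_ceiling_largestPrime_pairs {κ : Type*} [Fintype κ] [DecidableEq κ]
    (U : Finset (Fin (S.n + 1))) (t₁ : Fin S.n) (ht₁ : t₁.succ ∈ U)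
    (E : POVM (Fin (S.n + 1) → ZMod S.M) κ) {ε : ℝ}
    (hε : ∀ p ∈ (S.Q : ℕ).primeFactors, 32 * ε * (p : ℝ) ^ 2 ≤ 1) (hE : S.AlmostSureOn ε U E)
    {b₂ v₂ b₃ v₃ : Fin (S.n + 1) → ℤ} (hI₂ : S.InClass U b₂ v₂) (hI₃ : S.InClass U b₃ v₃)
    (a : ℤ) (m : Fin (S.n + 1) → ℤ) (hm0 : m 0 = 0) (hmU : ∀ i, i ∉ U → m i = 0)
    (hv : ∀ i, ((v₃ i : ℤ) : ZMod S.M)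
      = ((v₂ i + 2 * (S.D : ℤ) * S.D * S.p₁ * (a * b₂ i + m i) : ℤ) : ZMod S.M))
    {k₂ k₃ : κ} (hk₂ : E.AlmostCertain ε (S.inst b₂ v₂).phi7d k₂)
    (hk₃ : E.AlmostCertain ε (S.inst b₃ v₃).phi7d k₃) :
    k₂ = k₃ := by
  classical
  -- pass to the instance `S₂ := (b₂, v₂)`; its class `InClass U` is the class of `S`
  set S₂ : Shape := S.inst b₂ v₂ with hS₂
  have h₂ : S₂.Admissible := hI₂.2
  have h₃ : (S.inst b₃ v₃).Admissible := hI₃.2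
  have hb₂0 : b₂ 0 = -1 := h₂.b_head
  have hb₃0 : b₃ 0 = -1 := h₃.b_head
  have hbt₂ : ∀ i, i ≠ 0 → 2 * (S.p₁ : ℤ) ∣ b₂ i := h₂.b_tail
  have hbt₃ : ∀ i, i ≠ 0 → 2 * (S.p₁ : ℤ) ∣ b₃ i := h₃.b_tail
  have hE₂ : S₂.AlmostSureOn ε U E := by
    intro b v hI
    refine hE b v ⟨fun i hi => ?_, hI.2⟩
    rw [hI.1 i hi]
    exact hI₂.1 i hi
  -- the slopes `b₃` are the dummy family `β` of `S₂` modulo `P`, `β` on the unknown coordinates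
  set β : Fin S.n → ZMod S.Q :=
    fun t => ((((b₃ t.succ - b₂ t.succ) / (2 * (S.p₁ : ℤ)) : ℤ)) : ZMod S.Q) with hβ
  have hp0 : (2 * (S.p₁ : ℤ)) ≠ 0 := by
    have : (0 : ℤ) < S.p₁ := by exact_mod_cast S.p₁.pos
    positivity
  have hbP : ∀ i, ((S.P : ℕ) : ℤ) ∣ b₃ i - S₂.famBT Finset.univ β i := by
    intro i
    refine Fin.cases ?_ (fun t => ?_) i
    · rw [famBT_zero, hb₃0, sub_self]
      exact dvd_zero _
    · obtain ⟨d, hd⟩ : 2 * (S.p₁ : ℤ) ∣ b₃ t.succ - b₂ t.succ :=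
        dvd_sub (hbt₃ t.succ (Fin.succ_ne_zero t)) (hbt₂ t.succ (Fin.succ_ne_zero t))
      have hβt : β t = ((d : ℤ) : ZMod S.Q) := by
        simp only [hβ, hd, Int.mul_ediv_cancel_left _ hp0]
      have hb2 : 2 * (S.p₁ : ℤ) * (b₂ t.succ / (2 * (S.p₁ : ℤ))) = b₂ t.succ :=
        Int.mul_ediv_cancel' (hbt₂ t.succ (Fin.succ_ne_zero t))
      have hB : S₂.famBT Finset.univ β t.succ = b₂ t.succ + 2 * (S.p₁ : ℤ) * ((β t).val : ℤ) := by
        rw [famBT_succ]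
        unfold BfamT
        simp only [Finset.mem_univ, if_true]
        show 2 * (S.p₁ : ℤ) * (b₂ t.succ / (2 * (S.p₁ : ℤ)) + ((β t).val : ℤ)) = _
        rw [mul_add, hb2]
      have hval : ((β t).val : ℤ) = d % ((S.Q : ℕ) : ℤ) := by
        rw [hβt]
        exact ZMod.val_intCast d
      have hdm : ((S.Q : ℕ) : ℤ) * (d / ((S.Q : ℕ) : ℤ)) + d % ((S.Q : ℕ) : ℤ) = d :=
        Int.mul_ediv_add_emod d _
      rw [hB, hval, S.P_int_eq]
      exact ⟨2 * (d / ((S.Q : ℕ) : ℤ)), by linear_combination hd - 2 * (S.p₁ : ℤ) * hdm⟩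
  have hβT0 : ∀ t : Fin S.n, t.succ ∉ U → β t = 0 := by
    intro t hsU
    simp only [hβ, hI₃.1 _ hsU, hI₂.1 _ hsU, sub_self, Int.zero_ediv, Int.cast_zero]
  -- `v₃ ≡ v₂ + L·e (mod M)`, `e := a·b₂ + m`: `|φ7.d(b₃, v₃)⟩ = |φ7.d(famBT univ β, v₂ + L·e)⟩`
  set e : Fin (S.n + 1) → ℤ := fun i => a * b₂ i + m i with he
  have hφ₃ : (S.inst b₃ v₃).phi7d
      = (S₂.inst (S₂.famBT Finset.univ β) (fun i => S₂.v' i + S₂.L * e i)).phi7d := by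
    have h1 : (S.inst b₃ v₃).phi7d = (S.inst (S₂.famBT Finset.univ β) v₃).phi7d :=
      S.phi7d_inst_congr_b v₃ hbP
    have h2 : (S.inst (S₂.famBT Finset.univ β) v₃).phi7d
        = (S.inst (S₂.famBT Finset.univ β) (fun i => v₂ i + S.L * e i)).phi7d :=
      S.phi7d_inst_congr _ _ v₃ fun i => by
        rw [hv i]
        simp only [Shape.L, he]
    exact h1.trans h2
  -- both states as members of the base class of `S₂`
  set c : S₂.Coset := S₂.cosetOf S₂.v' with hc
  set x₀ : ZMod S.Q := ((S₂.quotOf S₂.v' 0 : ℤ) : ZMod S.Q) with hx₀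
  set y₀ : Fin S.n → ZMod S.Q := fun t => ((S₂.quotOf S₂.v' t.succ : ℤ) : ZMod S.Q) with hy₀
  have hφS : S₂.phi7d = (S₂.cshape c).uKet 0 x₀ y₀ := S₂.phi7d_eq_uKet h₂
  have hφS' : (S.inst b₃ v₃).phi7d
      = (S₂.cshape c).uKet β (x₀ - (a : ZMod S.Q))
          (fun t => y₀ t + (a : ZMod S.Q) * ((b₂ t.succ : ℤ) : ZMod S.Q)
            + ((m t.succ : ℤ) : ZMod S.Q)) := by
    rw [hφ₃, S₂.phi7d_inst_famBT_shift_eq_uKet h₂ β e]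
    have hb : S₂.b = b₂ := rfl
    congr 1
    · rw [hx₀]
      simp only [he, hm0]
      rw [hb₂0]
      push_cast
      ring
    · funext t
      simp only [he, hy₀]
      push_cast
      ring
  have h₀ : (S₂.cshape c).Admissible := S₂.cshape_admissible h₂ c
  -- the unknown tail coordinates
  set T : Finset (Fin S.n) := Finset.univ.filter fun t => t.succ ∈ U with hT
  have hTU : ∀ t ∈ T, t.succ ∈ U := fun t ht => (Finset.mem_filter.1 ht).2
  have hTne : T.Nonempty := ⟨t₁, Finset.mem_filter.2 ⟨Finset.mem_univ _, ht₁⟩⟩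
  have hE₀ : (S₂.cshape c).AlmostSureOn ε U E := fun b v hI => hE₂ b v hI
  have hmem : ∀ (β : Fin S.n → ZMod S.Q) (x : ZMod S.Q) (yb : Fin S.n → ZMod S.Q),
      (∀ t, t ∉ T → β t = 0) → ∃ k, E.AlmostCertain ε ((S₂.cshape c).uKet β x yb) k :=
    fun β x yb hβ => (S₂.cshape c).exists_almostCertain_uKet h₀ hTU hE₀ β x yb hβ
  have hβT : ∀ t, t ∉ T → β t = 0 := fun t ht =>
    hβT0 t fun hs => ht (Finset.mem_filter.2 ⟨Finset.mem_univ _, hs⟩)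
  -- straightened coordinates of the first state: `Z_{x₀, w₀}`
  set w₀ : Fin S.n → ZMod S.Q := y₀ + x₀ • (S₂.cshape c).bbar with hw₀
  have hbbar : ∀ t, (S₂.cshape c).bbar t = ((b₂ t.succ : ℤ) : ZMod S.Q) := fun _ => rfl
  have hz₁ : (S₂.cshape c).zKet x₀ w₀ = (S.inst b₂ v₂).phi7d := by
    rw [show (S.inst b₂ v₂).phi7d = S₂.phi7d from rfl, hφS, Shape.zKet, hw₀, add_sub_cancel_right]
  -- the second state has the same known straightened coordinates
  have hcls : ∀ t, t ∉ T →
      (y₀ t + (a : ZMod S.Q) * ((b₂ t.succ : ℤ) : ZMod S.Q) + ((m t.succ : ℤ) : ZMod S.Q))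
        + (x₀ - (a : ZMod S.Q)) * (S₂.cshape c).bbar t = w₀ t := by
    intro t ht
    have hsU : t.succ ∉ U := fun hs => ht (Finset.mem_filter.2 ⟨Finset.mem_univ _, hs⟩)
    rw [hmU _ hsU, hw₀, Pi.add_apply, Pi.smul_apply, smul_eq_mul, hbbar t]
    push_cast
    ring
  rw [hφS'] at hk₃
  rw [← hz₁] at hk₂
  exact ((S₂.cshape c).sameOut_uKet h₀ hTne E hmem hε hβT (x₀ - (a : ZMod S.Q)) x₀ hcls hk₃ hk₂).symm

end Shape

end Literature.Computability.Cryptography.Chen2024
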